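import Literature.Probability.RandomPlanarGeometry.HexSAWSurfaceWallRenewalSlackTwoClassification
import HarnessLib

/-!
# Slack four, four down steps: the six families of the shallow profiles (A11–A15, B5)

Self-avoiding walk on the honeycomb lattice in its brick-wall frame (`Eight.adjE`: horizontal steps everywhere, a
vertical edge `(x, y)–(x, y+1)` iff `x + y` is even), in the half-plane `Y ≤ 0`.  An IRREDUCIBLE POSITIVE WALL BRIDGE
`ω ∈ ipwb n` with `v = visits n ω` surface visits has SLACK `n − 6v`; at slack four (`n = 6k + 4`, `v = k ≥ 2`) it has
`2 ≤ #down ≤ 4` down steps (`…IteratedGap`), and for FOUR down steps the vertical profile is one of five Dyck words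
(`…SlackFourFourDown`: `DDDDUUUU`, `DDDUDUUU`, `DDDUUDUU`, `DDUDDUUU`, `DDUUDDUU`).  The companion module
`…SlackFourFourDownFamiliesDeep` constructs the four families of the deepest profile `D D D D U U U U`; this module
    constructs
the blocks of the other four profiles (bottom row `−3`,
    or `−2` twice for `D D U U D D U U`) explicitly: SIX FAMILIES, each an
affine nine-piece table walk (`Tab.walk` of `…SlackTwoFamilies` §0),
    and proves that they are irreducible positive wall bridges
of length `6k + 4` with `k` visits,
    four down steps and four up steps at explicit affine times.  Separation and counting of the
ten families follow in a successor module.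

Families (run words; `R`/`L` = right/left unit steps, `D`/`U` = down/up; all parameters natural numbers):
* A11 `s4e k a i j d g` (`D D D U D U U U`) : `R^{2a+1} D L^{2a−1} D R^{2i+1} D R^{2j+2} U R^{2d+2} D
    R^{2k−2i−2j−2d−6} U L^{2g+1} U
  L^{2k−2a−2g−3} U R^{2k−2a−1}`, `1 ≤ a`, `i + j + d + g + 4 ≤ k`, `g + a + 2 ≤ k` (hairpin opening,
      a dip on the way out) —
  `(k−3)(k−2)(k−1)k(2k−3)/60` blocks (`2, 14, 54, 154, 364` for `k = 4, …, 8`);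
* A12 `s4f k i j d g` (`D D D U D U U U`) : `R^{2k−1} D L^{2k−3} D R^{2i+1} D R^{2j+2} U R^{2d+2} D
    R^{2k−2i−2j−2d−2g−8} U R^{2g+1} U
  R U R`, `i + j + d + g + 5 ≤ k` — `C(k−1,4)` blocks (`1, 5, 15, 35` for `k = 5, …, 8`);
* A13 `s4g k a i d e g` (`D D D U U D U U`) : `R^{2a+1} D L^{2a−1} D R^{2i+1} D R^{2k−2i−2} U L^{2d+1} U L^{2e+2} D
    L^{2g+2} U
  L^{2k−2a−2d−2e−2g−7} U R^{2k−2a−1}`, `1 ≤ a`, `a + d + e + g + 4 ≤ k`, `i + d + e + g + 4 ≤ k` (bottom exit,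
      a dip on the way
  back) — `2·C(k,5)` blocks (`2, 12, 42, 112` for `k = 5, …, 8`);
* A14 `s4h k a i j d g` (`D D U D D U U U`) : `R^{2a+1} D L^{2i+1} D L^{2j+2} U L^{2a−2i−2j−4} D R^{2d+1} D
    R^{2k−2d−2} U L^{2g+1} U
  L^{2k−2a−2g−3} U R^{2k−2a−1}`, `d + i + j + 3 ≤ a`, `g + a + 2
      ≤ k` (a dip on the way down to column `2`) — `C(k,5)` blocks
  (`1, 6, 21, 56` for `k = 5, …, 8`);
* A15 `s4i k i j d g` (`D D U D D U U U`) : `R^{2k−1} D L^{2i+1} D L^{2j+2} U L^{2k−2i−2j−6} D R^{2d+1} D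
    R^{2k−2d−2g−4} U R^{2g+1} U R
  U R`, `d + i + j + 4 ≤ k`, `g ≤ i` (wall run of length `2k−1`, staircase exit) — `C(k,4)` blocks (`1, 5, 15, 35,
      70` for
  `k = 4, …, 8`);
* B5 `s4j k a` (`D D U U D D U U`, span `2k
    + 4`) : `R^{2a+1} D L^{2a−1} D R^{2a} U R U R^{2k−2a−2} D L^{2k−2a−3} D R^{2k−2a−2} U R
  U R`, `1 ≤ a ≤ k − 2` (two hairpin bodies of width `2` joined by a wall run) — `k − 2` blocks.
A11–A15 have span `X = 2k + 2` and resurface at column `p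
    + 2` where `p` is the length of the initial wall run; B5 resurfaces
twice (the labels are those of the lane's family catalogue).

Main statements (namespace `…SAW.HexBW.Wall`; `m = 6k + 4` symbolic throughout): per family `F ∈ {s4e, s4f, s4g, s4h,
    s4i,
s4j}` the tables `FX`, `FY`, the walk `F`, `F_facts` (`Tab.Facts`), `F_mem_pwb`, `F_apply`,
    ★ `F_mem_ipwb` (irreducibility by
explicit witnesses), ★ `visits_F = k`, ★ `stepsD_F = {d₁, d₂, d₃, d₄}` and `stepsU_F = {u₁, u₂, u₃,
    u₄}` (explicit affine
times, listed increasingly).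

PROOFS.  Every statement is linear arithmetic over the affine pieces of the tables (`F_cases`,
    by `split_ifs`): adjacency
through `Eight.adjE`, self-avoidance = same-row interval disjointness,
    irreducibility through `mem_ipwb_of_facts_wit` (each
interior visit of the initial wall run is followed by the body's return to column `2`,
    each interior visit of the final wall
run — there are none when `p = 2k − 1` — is preceded by the bottom exit column `2k
    + 1`; for B5 each interior visit of the
middle wall run (columns `≥ 2a + 4`) is followed by the second body's return to column `2a + 4`), visits through
`visits_add_of_wall` / `visits_add_eq_left` on the alternating wall / off-wall segments,
    the vertical steps read off the tables.

STATUS: lane theorem of the a-idea-1 bridge/renewal lineage (successor of car 85 `…SlackFourThreeDownFamilies`); car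
    95-B
«slack four: four down families, shallow profiles».  OURS (new in writing, modest): the six explicit families.  CHECKED
against the lane's complete enumeration of the irreducible positive wall bridges of length `6k + 4` with `k` visits for
`k = 2, …, 8`: together with the four families of `…SlackFourFourDownFamiliesDeep` the ten families are pairwise
    disjoint,
injectively parametrised, and their union is EXACTLY the four-down stratum (`0, 3, 27, 129, 424, 1105, 2463` blocks for
`k = 2, …, 8`; no duplicate, no omission; by profile `DDDUDUUU` `0, 0, 2, 15, 59, 169, 399`, `DDDUUDUU` `2·C(k,5)`,
`DDUDDUUU` `C(k+1,5)`, `DDUUDDUU` `k − 2`), in accordance with the recorded four-down law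
`12·#{#stepsD = 4} = (k−2)(2k⁴ − 7k³ + 4k² + 7k + 6)` (computed, `k ≤ 15`).  The printed sources carry the renewal /
irreducible-bridge structure (Madras–Slade §4.2, Definition 4.2.1, (4.2.2); Definition 1.2.4; Kesten),
    the brickwork frame of
the honeycomb lattice (Enting–Jensen §7.4.2,
    Fig. 7.10) and the surface-visit statistic (Beaton et al. §3.1) — none lists these
families.  No `set_option` line is used.
-/

namespace Literature.Probability.RandomPlanarGeometry.SAW.HexBW.Wall

open Finset Filter Function
open Literature.Probability.LatticeModels Literature.Probability.Percolation SimpleGraph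

variable {n : ℕ} {ω : ℕ → Site 2}

/-! ### §0  Private tools -/

/-- The Boolean adjacency test `Eight.adjE` read as a proposition. [folklore] -/
private theorem adjE_iff_fs {a b c d : ℤ} : Eight.adjE a b c d = true ↔
    ((c = a + 1 ∨ a = c + 1) ∧ d = b) ∨ (c = a ∧ ((d = b + 1 ∧ (a + b) % 2 = 0) ∨ (b = d + 1 ∧ (c + d) % 2 = 0))) := by
  simp [Eight.adjE]

/-! ### §1  Family A11 (`D D D U D U U U`, hairpin opening,
    a dip on the way out): `R^{2a+1} D L^{2a−1} D R^{2i+1} D R^{2j+2} U R^{2d+2} D R^{2k−2i−2j−2d−6} U L^{2g+1} U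
    L^{2k−2a−2g−3} U R^{2k−2a−1}` -/

/-- Column table of the s4e blocks (length `6k + 4`, vertical profile `D D D U D U U U`),
    9 affine pieces on the rows `0, −1, −2, −3, −2, −3, −2, −1, 0` (values `(t : ℤ)`, `-(t : ℤ) + 4 * a + 3`,
    `(t : ℤ) - 4 * a`, `(t : ℤ) - 4 * a - 1`, `(t : ℤ) - 4 * a - 2`, `(t : ℤ) - 4 * a - 3`, `-(t : ℤ) + 4 * k
    + 4 * a + 6`, `-(t : ℤ) + 4 * k + 4 * a + 7`,
    `(t : ℤ) - 4 * k - 2` on the successive pieces). [cite: EntingJensen2009, §7.4.2,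
    Fig. 7.10 (brickwork form of the honeycomb lattice)] -/
def s4eX (k a i j d g t : ℕ) : ℤ :=
  if t ≤ 2 * a + 1 then (t : ℤ)
  else if t ≤ 4 * a + 1 then -(t : ℤ) + 4 * a + 3
  else if t ≤ 4 * a + 2 * i + 3 then (t : ℤ) - 4 * a
  else if t ≤ 4 * a + 2 * i + 2 * j + 6 then (t : ℤ) - 4 * a - 1
  else if t ≤ 4 * a + 2 * i + 2 * j + 2 * d + 9 then (t : ℤ) - 4 * a - 2
  else if t ≤ 2 * k + 4 * a + 4 then (t : ℤ) - 4 * a - 3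
  else if t ≤ 2 * k + 4 * a + 2 * g + 6 then -(t : ℤ) + 4 * k + 4 * a + 6
  else if t ≤ 4 * k + 2 * a + 4 then -(t : ℤ) + 4 * k + 4 * a + 7
  else (t : ℤ) - 4 * k - 2

/-- Height table of the s4e blocks: `0, −1, −2, −3, −2, −3, −2, −1, 0` on the 9 pieces. [cite: EntingJensen2009,
    §7.4.2, Fig. 7.10] -/
def s4eY (k a i j d g t : ℕ) : ℤ :=
  if t ≤ 2 * a + 1 then 0
  else if t ≤ 4 * a + 1 then -1
  else if t ≤ 4 * a + 2 * i + 3 then -2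
  else if t ≤ 4 * a + 2 * i + 2 * j + 6 then -3
  else if t ≤ 4 * a + 2 * i + 2 * j + 2 * d + 9 then -2
  else if t ≤ 2 * k + 4 * a + 4 then -3
  else if t ≤ 2 * k + 4 * a + 2 * g + 6 then -2
  else if t ≤ 4 * k + 2 * a + 4 then -1
  else 0

/-- **The A11 block**
    `(0,0)→…→(2a+1,0)↓←…←(2,−1)↓(2,−2)→…↓→…→(2i+2j+5,−3)↑→…↓→…→(2k+1,−3)↑←…↑←…←(2a+3,−1)↑(2a+3,0)→…→(2k+2,0)` of
    length `6k+4`. [cite: EntingJensen2009, §7.4.2, Fig. 7.10] -/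
def s4e (k a i j d g : ℕ) : ℕ → Site 2 := Tab.walk (6 * k + 4) (s4eX k a i j d g) (s4eY k a i j d g)

/-- The affine pieces of the tables of `s4e`, with their values. [cite: EntingJensen2009, §7.4.2, Fig. 7.10] -/
private theorem s4e_cases (k a i j d g t : ℕ) :
    (t ≤ 2 * a + 1 ∧ s4eX k a i j d g t = (t : ℤ) ∧ s4eY k a i j d g t = 0) ∨
      (2 * a + 2 ≤ t ∧ t ≤ 4 * a + 1 ∧ s4eX k a i j d g t = -(t : ℤ) + 4 * a + 3 ∧ s4eY k a i j d g t = -1) ∨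
      (4 * a + 2 ≤ t ∧ t ≤ 4 * a + 2 * i + 3 ∧ s4eX k a i j d g t = (t : ℤ) - 4 * a ∧ s4eY k a i j d g t = -2) ∨
      (4 * a + 2 * i + 4 ≤ t ∧ t ≤ 4 * a + 2 * i + 2 * j + 6 ∧ s4eX k a i j d g t = (t : ℤ) - 4 * a - 1
          ∧ s4eY k a i j d g t = -3) ∨
      (4 * a + 2 * i + 2 * j + 7 ≤ t ∧ t ≤ 4 * a + 2 * i + 2 * j + 2 * d + 9 ∧ s4eX k a i j d g t
          = (t : ℤ) - 4 * a - 2 ∧ s4eY k a i j d g t = -2) ∨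
      (4 * a + 2 * i + 2 * j + 2 * d + 10 ≤ t ∧ t ≤ 2 * k + 4 * a + 4 ∧ s4eX k a i j d g t = (t : ℤ) - 4 * a - 3
          ∧ s4eY k a i j d g t = -3) ∨
      (2 * k + 4 * a + 5 ≤ t ∧ t ≤ 2 * k + 4 * a + 2 * g + 6 ∧ s4eX k a i j d g t = -(t : ℤ) + 4 * k + 4 * a + 6
          ∧ s4eY k a i j d g t = -2) ∨
      (2 * k + 4 * a + 2 * g + 7 ≤ t ∧ t ≤ 4 * k + 2 * a + 4 ∧ s4eX k a i j d g t = -(t : ℤ) + 4 * k + 4 * a + 7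
          ∧ s4eY k a i j d g t = -1) ∨
      (4 * k + 2 * a + 5 ≤ t ∧ s4eX k a i j d g t = (t : ℤ) - 4 * k - 2 ∧ s4eY k a i j d g t = 0) := by
  simp only [s4eX, s4eY]
  split_ifs
  · exact Or.inl ⟨by omega, by omega, by omega⟩
  · exact Or.inr (Or.inl ⟨by omega, by omega, by omega, by omega⟩)
  · exact Or.inr (Or.inr (Or.inl ⟨by omega, by omega, by omega, by omega⟩))
  · exact Or.inr (Or.inr (Or.inr (Or.inl ⟨by omega, by omega, by omega, by omega⟩)))
  · exact Or.inr (Or.inr (Or.inr (Or.inr (Or.inl ⟨by omega, by omega, by omega, by omega⟩))))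
  · exact Or.inr (Or.inr (Or.inr (Or.inr (Or.inr (Or.inl ⟨by omega, by omega, by omega, by omega⟩)))))
  · exact Or.inr (Or.inr (Or.inr (Or.inr (Or.inr (Or.inr (Or.inl ⟨by omega, by omega, by omega, by omega⟩))))))
  · exact Or.inr (Or.inr (Or.inr (Or.inr (Or.inr (Or.inr (Or.inr (Or.inl ⟨by omega, by omega, by omega, by omega⟩)))))))
  · exact Or.inr (Or.inr (Or.inr (Or.inr (Or.inr (Or.inr (Or.inr (Or.inr (⟨by omega, by omega, by omega⟩))))))))

/-- **Coordinate facts of `s4e`** (`1 ≤ a`, `i + j + d + g + 4 ≤ k`, `a + g + 2 ≤ k`): brick-wall steps,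
    self-avoidance, lower half-plane, columns in
`[0, X_L]` and `≥ 1` after time `0`, start and end on the wall, even length. [cite: EntingJensen2009, §7.4.2, Fig. 7.10]
[cite: MadrasSlade1993, §1.2, Definition 1.2.4 (bridges, p. 11)] -/
theorem s4e_facts {k a i j d g : ℕ} (ha : 1 ≤ a) (hs : i + j + d + g + 4 ≤ k) (hga : a + g + 2
    ≤ k) : Tab.Facts (6 * k + 4) (s4eX k a i j d g) (s4eY k a i j d g) := by
  refine ⟨fun t ht => ?_, fun t ht s hs hx hy => ?_, fun t ht => ?_, fun t ht => ?_, ?_, ?_, ?_, by omega,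
      fun t ht h1 => ?_⟩
  · rw [adjE_iff_fs]
    rcases s4e_cases k a i j d g t with ⟨h, x, y⟩ | ⟨l, h, x, y⟩ | ⟨l, h, x, y⟩ | ⟨l, h, x, y⟩ | ⟨l, h, x, y⟩ | ⟨l,
        h, x, y⟩ | ⟨l, h, x, y⟩ | ⟨l, h, x, y⟩ | ⟨l, x, y⟩ <;>
      rcases s4e_cases k a i j d g (t + 1) with ⟨h', x', y'⟩ | ⟨l', h', x', y'⟩ | ⟨l', h', x', y'⟩ | ⟨l', h', x',
          y'⟩ | ⟨l', h', x', y'⟩ | ⟨l', h', x', y'⟩ | ⟨l', h', x', y'⟩ | ⟨l', h', x', y'⟩ | ⟨l', x', y'⟩ <;>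
        omega
  · rcases s4e_cases k a i j d g t with ⟨h, x, y⟩ | ⟨l, h, x, y⟩ | ⟨l, h, x, y⟩ | ⟨l, h, x, y⟩ | ⟨l, h, x, y⟩ | ⟨l,
      h, x, y⟩ | ⟨l, h, x, y⟩ | ⟨l, h, x, y⟩ | ⟨l, x, y⟩ <;>
      rcases s4e_cases k a i j d g s with ⟨h', x', y'⟩ | ⟨l', h', x', y'⟩ | ⟨l', h', x', y'⟩ | ⟨l', h', x',
          y'⟩ | ⟨l', h', x', y'⟩ | ⟨l', h', x', y'⟩ | ⟨l', h', x', y'⟩ | ⟨l', h', x', y'⟩ | ⟨l', x', y'⟩ <;>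
        omega
  · rcases s4e_cases k a i j d g t with ⟨h, x, y⟩ | ⟨l, h, x, y⟩ | ⟨l, h, x, y⟩ | ⟨l, h, x, y⟩ | ⟨l, h, x, y⟩ | ⟨l,
      h, x, y⟩ | ⟨l, h, x, y⟩ | ⟨l, h, x, y⟩ | ⟨l, x, y⟩ <;> omega
  · have h0 := s4e_cases k a i j d g 0
    have hL := s4e_cases k a i j d g (6 * k + 4)
    rcases s4e_cases k a i j d g t with ⟨h, x, y⟩ | ⟨l, h, x, y⟩ | ⟨l, h, x, y⟩ | ⟨l, h, x, y⟩ | ⟨l, h, x, y⟩ | ⟨l,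
        h, x, y⟩ | ⟨l, h, x, y⟩ | ⟨l, h, x, y⟩ | ⟨l, x, y⟩ <;> omega
  · have h0 := s4e_cases k a i j d g 0; omega
  · have h0 := s4e_cases k a i j d g 0; omega
  · have hL := s4e_cases k a i j d g (6 * k + 4); omega
  · rcases s4e_cases k a i j d g t with ⟨h, x, y⟩ | ⟨l, h, x, y⟩ | ⟨l, h, x, y⟩ | ⟨l, h, x, y⟩ | ⟨l, h, x, y⟩ | ⟨l,
      h, x, y⟩ | ⟨l, h, x, y⟩ | ⟨l, h, x, y⟩ | ⟨l, x, y⟩ <;> omega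

/-- `s4e` is a positive wall bridge of length `m = 6k + 4` (length symbolic). [cite: MadrasSlade1993, §1.2,
    Definition 1.2.4 (p. 11)]
[cite: EntingJensen2009, §7.4.2, Fig. 7.10] -/
theorem s4e_mem_pwb {k a i j d g m : ℕ} (ha : 1 ≤ a) (hs : i + j + d + g + 4 ≤ k) (hga : a + g + 2 ≤ k) (hm : m
    = 6 * k + 4) : s4e k a i j d g ∈ pwb m :=
  mem_pwb_of_facts rfl (s4e_facts ha hs hga) hm

/-- Coordinates of `s4e` up to its length. [cite: EntingJensen2009, §7.4.2, Fig. 7.10] -/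
theorem s4e_apply {k a i j d g t : ℕ} (ht : t ≤ 6 * k + 4) : s4e k a i j d g t 0 = s4eX k a i j d g t
    ∧ s4e k a i j d g t 1 = s4eY k a i j d g t :=
  tab_walk_apply ht

/-- **`s4e` is irreducible**: the interior visits of the initial wall run are followed by the return to column `2`,
    those of the final wall run (columns `≤ 2k`) are preceded by the bottom exit column `2k+1` (row `−3`). [cite:
    MadrasSlade1993, §4.2, Definition 4.2.1 (p. 90)]
[cite: Kesten1963SAW, §4] [cite: EntingJensen2009, §7.4.2, Fig. 7.10] -/
theorem s4e_mem_ipwb {k a i j d g m : ℕ} (ha : 1 ≤ a) (hs : i + j + d + g + 4 ≤ k) (hga : a + g + 2 ≤ k) (hm : m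
    = 6 * k + 4) : s4e k a i j d g ∈ ipwb m := by
  refine mem_ipwb_of_facts_wit rfl (s4e_facts ha hs hga) hm (by omega) fun t ht1 ht2 hte hY => ?_
  rcases s4e_cases k a i j d g t with ⟨h, x, y⟩ | ⟨l, h, x, y⟩ | ⟨l, h, x, y⟩ | ⟨l, h, x, y⟩ | ⟨l, h, x, y⟩ | ⟨l, h,
      x, y⟩ | ⟨l, h, x, y⟩ | ⟨l, h, x, y⟩ | ⟨l, x, y⟩
  · refine Or.inl ⟨4 * a + 1, by omega, by omega, ?_⟩
    rcases s4e_cases k a i j d g (4 * a + 1) with ⟨h', x', y'⟩ | ⟨l', h', x', y'⟩ | ⟨l', h', x', y'⟩ | ⟨l', h', x',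
        y'⟩ | ⟨l', h', x', y'⟩ | ⟨l', h', x', y'⟩ | ⟨l', h', x', y'⟩ | ⟨l', h', x', y'⟩ | ⟨l', x', y'⟩ <;>
      omega
  · omega
  · omega
  · omega
  · omega
  · omega
  · omega
  · omega
  · refine Or.inr ⟨2 * k + 4 * a + 4, by omega, by omega, ?_⟩
    rcases s4e_cases k a i j d g (2 * k + 4 * a + 4) with ⟨h', x', y'⟩ | ⟨l', h', x', y'⟩ | ⟨l', h', x', y'⟩ | ⟨l',
        h', x', y'⟩ | ⟨l', h', x', y'⟩ | ⟨l', h', x', y'⟩ | ⟨l', h', x', y'⟩ | ⟨l', h', x', y'⟩ | ⟨l', x', y'⟩ <;>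
      omega

/-- **`s4e` has `k` visits** (`a` on the initial wall run, `k − a` on the final one).
[cite: BeatonBousquetMelouDeGierDuminilCopinGuttmann2014, §3.1 (arXiv v5 p. 8)] [cite: EntingJensen2009, §7.4.2,
    Fig. 7.10] -/
theorem visits_s4e {k a i j d g m : ℕ} (ha : 1 ≤ a) (hs : i + j + d + g + 4 ≤ k) (hga : a + g + 2 ≤ k) (hm : m
    = 6 * k + 4) : visits m (s4e k a i j d g) = k := by
  have hY : ∀ t, t ≤ 6 * k + 4 → s4e k a i j d g t 1 = s4eY k a i j d g t := fun t ht => (s4e_apply ht).2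
  have h1 : visits (0 + (2 * a + 1)) (s4e k a i j d g) = visits (0) (s4e k a i j d g) + ((0 + (2 * a
      + 1)) / 2 - (0) / 2) :=
    visits_add_of_wall fun q _ hq => by
      rw [hY _ (by omega)]
      rcases s4e_cases k a i j d g (0 + q) with ⟨h', x', y'⟩ | ⟨l', h', x', y'⟩ | ⟨l', h', x', y'⟩ | ⟨l', h', x',
          y'⟩ | ⟨l', h', x', y'⟩ | ⟨l', h', x', y'⟩ | ⟨l', h', x', y'⟩ | ⟨l', h', x', y'⟩ | ⟨l', x', y'⟩ <;>
        omega
  have h2 : visits (2 * a + 1 + (4 * k + 3)) (s4e k a i j d g) = visits (2 * a + 1) (s4e k a i j d g) :=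
    visits_add_eq_left fun q hq1 hq2 h => by
      obtain ⟨-, h0⟩ := h
      rw [hY _ (by omega)] at h0
      rcases s4e_cases k a i j d g (2 * a + 1 + q) with ⟨h', x', y'⟩ | ⟨l', h', x', y'⟩ | ⟨l', h', x', y'⟩ | ⟨l', h',
          x', y'⟩ | ⟨l', h', x', y'⟩ | ⟨l', h', x', y'⟩ | ⟨l', h', x', y'⟩ | ⟨l', h', x', y'⟩ | ⟨l', x', y'⟩ <;> omega
  have h3 : visits (4 * k + 2 * a + 4 + (2 * k - 2 * a)) (s4e k a i j d g) = visits (4 * k + 2 * a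
      + 4) (s4e k a i j d g) + ((4 * k + 2 * a + 4 + (2 * k - 2 * a)) / 2 - (4 * k + 2 * a + 4) / 2) :=
    visits_add_of_wall fun q _ hq => by
      rw [hY _ (by omega)]
      rcases s4e_cases k a i j d g (4 * k + 2 * a + 4 + q) with ⟨h', x', y'⟩ | ⟨l', h', x', y'⟩ | ⟨l', h', x',
          y'⟩ | ⟨l', h', x', y'⟩ | ⟨l', h', x', y'⟩ | ⟨l', h', x', y'⟩ | ⟨l', h', x', y'⟩ | ⟨l', h', x', y'⟩ | ⟨l',
          x', y'⟩ <;>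
        omega
  rw [zero_add, visits_zero, zero_add] at h1
  rw [show 2 * a + 1 + (4 * k + 3) = 4 * k + 2 * a + 4 by omega, h1] at h2
  rw [show 4 * k + 2 * a + 4 + (2 * k - 2 * a) = 6 * k + 4 by omega, h2] at h3
  subst hm
  rw [h3]
  omega

/-- **`s4e` has four down steps**, at the times `2 * a + 1`, `4 * a + 1`, `4 * a + 2 * i + 3`, `4 * a + 2 * i
    + 2 * j + 2 * d + 9`. [cite: EntingJensen2009, §7.4.2, Fig. 7.10] -/
theorem stepsD_s4e {k a i j d g m : ℕ} (ha : 1 ≤ a) (hs : i + j + d + g + 4 ≤ k) (hga : a + g + 2 ≤ k) (hm : m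
    = 6 * k + 4) :
    stepsD m (s4e k a i j d g) = {2 * a + 1, 4 * a + 1, 4 * a + 2 * i + 3, 4 * a + 2 * i + 2 * j + 2 * d + 9} := by
  subst hm
  ext t
  simp only [stepsD, mem_filter, mem_range, mem_insert, mem_singleton]
  constructor
  · rintro ⟨ht, hx, hy⟩
    rw [(s4e_apply (t := t + 1) (by omega)).1, (s4e_apply (t := t) (by omega)).1] at hx
    rw [(s4e_apply (t := t + 1) (by omega)).2, (s4e_apply (t := t) (by omega)).2] at hy
    rcases s4e_cases k a i j d g t with ⟨h, x, y⟩ | ⟨l, h, x, y⟩ | ⟨l, h, x, y⟩ | ⟨l, h, x, y⟩ | ⟨l, h, x, y⟩ | ⟨l,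
        h, x, y⟩ | ⟨l, h, x, y⟩ | ⟨l, h, x, y⟩ | ⟨l, x, y⟩ <;>
      rcases s4e_cases k a i j d g (t + 1) with ⟨h', x', y'⟩ | ⟨l', h', x', y'⟩ | ⟨l', h', x', y'⟩ | ⟨l', h', x',
          y'⟩ | ⟨l', h', x', y'⟩ | ⟨l', h', x', y'⟩ | ⟨l', h', x', y'⟩ | ⟨l', h', x', y'⟩ | ⟨l', x', y'⟩ <;>
        omega
  · intro ht
    have ht4 : t + 1 ≤ 6 * k + 4 := by omega
    refine ⟨by omega, ?_, ?_⟩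
    · rw [(s4e_apply ht4).1, (s4e_apply (t := t) (by omega)).1]
      rcases s4e_cases k a i j d g t with ⟨h, x, y⟩ | ⟨l, h, x, y⟩ | ⟨l, h, x, y⟩ | ⟨l, h, x, y⟩ | ⟨l, h, x, y⟩ | ⟨l,
          h, x, y⟩ | ⟨l, h, x, y⟩ | ⟨l, h, x, y⟩ | ⟨l, x, y⟩ <;>
        rcases s4e_cases k a i j d g (t + 1) with ⟨h', x', y'⟩ | ⟨l', h', x', y'⟩ | ⟨l', h', x', y'⟩ | ⟨l', h', x',
            y'⟩ | ⟨l', h', x', y'⟩ | ⟨l', h', x', y'⟩ | ⟨l', h', x', y'⟩ | ⟨l', h', x', y'⟩ | ⟨l', x', y'⟩ <;>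
          omega
    · rw [(s4e_apply ht4).2, (s4e_apply (t := t) (by omega)).2]
      rcases s4e_cases k a i j d g t with ⟨h, x, y⟩ | ⟨l, h, x, y⟩ | ⟨l, h, x, y⟩ | ⟨l, h, x, y⟩ | ⟨l, h, x, y⟩ | ⟨l,
          h, x, y⟩ | ⟨l, h, x, y⟩ | ⟨l, h, x, y⟩ | ⟨l, x, y⟩ <;>
        rcases s4e_cases k a i j d g (t + 1) with ⟨h', x', y'⟩ | ⟨l', h', x', y'⟩ | ⟨l', h', x', y'⟩ | ⟨l', h', x',
            y'⟩ | ⟨l', h', x', y'⟩ | ⟨l', h', x', y'⟩ | ⟨l', h', x', y'⟩ | ⟨l', h', x', y'⟩ | ⟨l', x', y'⟩ <;>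
          omega

/-- **`s4e` has four up steps**, at the times `4 * a + 2 * i + 2 * j + 6`, `2 * k + 4 * a + 4`, `2 * k + 4 * a
    + 2 * g + 6`, `4 * k + 2 * a + 4`. [cite: EntingJensen2009, §7.4.2, Fig. 7.10] -/
theorem stepsU_s4e {k a i j d g m : ℕ} (ha : 1 ≤ a) (hs : i + j + d + g + 4 ≤ k) (hga : a + g + 2 ≤ k) (hm : m
    = 6 * k + 4) :
    stepsU m (s4e k a i j d g) = {4 * a + 2 * i + 2 * j + 6, 2 * k + 4 * a + 4, 2 * k + 4 * a + 2 * g + 6, 4 * k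
        + 2 * a + 4} := by
  subst hm
  ext t
  simp only [stepsU, mem_filter, mem_range, mem_insert, mem_singleton]
  constructor
  · rintro ⟨ht, hx, hy⟩
    rw [(s4e_apply (t := t + 1) (by omega)).1, (s4e_apply (t := t) (by omega)).1] at hx
    rw [(s4e_apply (t := t + 1) (by omega)).2, (s4e_apply (t := t) (by omega)).2] at hy
    rcases s4e_cases k a i j d g t with ⟨h, x, y⟩ | ⟨l, h, x, y⟩ | ⟨l, h, x, y⟩ | ⟨l, h, x, y⟩ | ⟨l, h, x, y⟩ | ⟨l,
        h, x, y⟩ | ⟨l, h, x, y⟩ | ⟨l, h, x, y⟩ | ⟨l, x, y⟩ <;>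
      rcases s4e_cases k a i j d g (t + 1) with ⟨h', x', y'⟩ | ⟨l', h', x', y'⟩ | ⟨l', h', x', y'⟩ | ⟨l', h', x',
          y'⟩ | ⟨l', h', x', y'⟩ | ⟨l', h', x', y'⟩ | ⟨l', h', x', y'⟩ | ⟨l', h', x', y'⟩ | ⟨l', x', y'⟩ <;>
        omega
  · intro ht
    have ht4 : t + 1 ≤ 6 * k + 4 := by omega
    refine ⟨by omega, ?_, ?_⟩
    · rw [(s4e_apply ht4).1, (s4e_apply (t := t) (by omega)).1]
      rcases s4e_cases k a i j d g t with ⟨h, x, y⟩ | ⟨l, h, x, y⟩ | ⟨l, h, x, y⟩ | ⟨l, h, x, y⟩ | ⟨l, h, x, y⟩ | ⟨l,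
          h, x, y⟩ | ⟨l, h, x, y⟩ | ⟨l, h, x, y⟩ | ⟨l, x, y⟩ <;>
        rcases s4e_cases k a i j d g (t + 1) with ⟨h', x', y'⟩ | ⟨l', h', x', y'⟩ | ⟨l', h', x', y'⟩ | ⟨l', h', x',
            y'⟩ | ⟨l', h', x', y'⟩ | ⟨l', h', x', y'⟩ | ⟨l', h', x', y'⟩ | ⟨l', h', x', y'⟩ | ⟨l', x', y'⟩ <;>
          omega
    · rw [(s4e_apply ht4).2, (s4e_apply (t := t) (by omega)).2]
      rcases s4e_cases k a i j d g t with ⟨h, x, y⟩ | ⟨l, h, x, y⟩ | ⟨l, h, x, y⟩ | ⟨l, h, x, y⟩ | ⟨l, h, x, y⟩ | ⟨l,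
          h, x, y⟩ | ⟨l, h, x, y⟩ | ⟨l, h, x, y⟩ | ⟨l, x, y⟩ <;>
        rcases s4e_cases k a i j d g (t + 1) with ⟨h', x', y'⟩ | ⟨l', h', x', y'⟩ | ⟨l', h', x', y'⟩ | ⟨l', h', x',
            y'⟩ | ⟨l', h', x', y'⟩ | ⟨l', h', x', y'⟩ | ⟨l', h', x', y'⟩ | ⟨l', h', x', y'⟩ | ⟨l', x', y'⟩ <;>
          omega


/-! ### §2  Family A12 (`D D D U D U U U`, wall run of length `2k−1`, hairpin, a dip on the way out,
    staircase exit): `R^{2k−1} D L^{2k−3} D R^{2i+1} D R^{2j+2} U R^{2d+2} D R^{2k−2i−2j−2d−2g−8} U R^{2g+1} U R U R` -/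

/-- Column table of the s4f blocks (length `6k + 4`, vertical profile `D D D U D U U U`),
    9 affine pieces on the rows `0, −1, −2, −3, −2, −3, −2, −1, 0` (values `(t : ℤ)`, `-(t : ℤ) + 4 * k - 1`,
    `(t : ℤ) - 4 * k + 4`, `(t : ℤ) - 4 * k + 3`, `(t : ℤ) - 4 * k + 2`, `(t : ℤ) - 4 * k + 1`, `(t : ℤ) - 4 * k`,
    `(t : ℤ) - 4 * k - 1`, `(t : ℤ) - 4 * k - 2` on the successive pieces). [cite: EntingJensen2009, §7.4.2,
    Fig. 7.10 (brickwork form of the honeycomb lattice)] -/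
def s4fX (k i j d g t : ℕ) : ℤ :=
  if t + 1 ≤ 2 * k then (t : ℤ)
  else if t + 3 ≤ 4 * k then -(t : ℤ) + 4 * k - 1
  else if t + 1 ≤ 4 * k + 2 * i then (t : ℤ) - 4 * k + 4
  else if t ≤ 4 * k + 2 * i + 2 * j + 2 then (t : ℤ) - 4 * k + 3
  else if t ≤ 4 * k + 2 * i + 2 * j + 2 * d + 5 then (t : ℤ) - 4 * k + 2
  else if t + 2 * g + 2 ≤ 6 * k then (t : ℤ) - 4 * k + 1
  else if t ≤ 6 * k then (t : ℤ) - 4 * k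
  else if t ≤ 6 * k + 2 then (t : ℤ) - 4 * k - 1
  else (t : ℤ) - 4 * k - 2

/-- Height table of the s4f blocks: `0, −1, −2, −3, −2, −3, −2, −1, 0` on the 9 pieces. [cite: EntingJensen2009,
    §7.4.2, Fig. 7.10] -/
def s4fY (k i j d g t : ℕ) : ℤ :=
  if t + 1 ≤ 2 * k then 0
  else if t + 3 ≤ 4 * k then -1
  else if t + 1 ≤ 4 * k + 2 * i then -2
  else if t ≤ 4 * k + 2 * i + 2 * j + 2 then -3
  else if t ≤ 4 * k + 2 * i + 2 * j + 2 * d + 5 then -2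
  else if t + 2 * g + 2 ≤ 6 * k then -3
  else if t ≤ 6 * k then -2
  else if t ≤ 6 * k + 2 then -1
  else 0

/-- **The A12 block** `(0,0)→…→(2k−1,0)↓←…←(2,−1)↓(2,−2)→…↓→…↑→…↓→…↑→…→(2k,−2)↑(2k,−1)→(2k+1,−1)↑(2k+1,0)→(2k+2,0)`
    of length `6k+4`. [cite: EntingJensen2009, §7.4.2, Fig. 7.10] -/
def s4f (k i j d g : ℕ) : ℕ → Site 2 := Tab.walk (6 * k + 4) (s4fX k i j d g) (s4fY k i j d g)

/-- The affine pieces of the tables of `s4f`, with their values. [cite: EntingJensen2009, §7.4.2, Fig. 7.10] -/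
private theorem s4f_cases (k i j d g t : ℕ) :
    (t + 1 ≤ 2 * k ∧ s4fX k i j d g t = (t : ℤ) ∧ s4fY k i j d g t = 0) ∨
      (2 * k ≤ t ∧ t + 3 ≤ 4 * k ∧ s4fX k i j d g t = -(t : ℤ) + 4 * k - 1 ∧ s4fY k i j d g t = -1) ∨
      (4 * k ≤ t + 2 ∧ t + 1 ≤ 4 * k + 2 * i ∧ s4fX k i j d g t = (t : ℤ) - 4 * k + 4 ∧ s4fY k i j d g t = -2) ∨
      (4 * k + 2 * i ≤ t ∧ t ≤ 4 * k + 2 * i + 2 * j + 2 ∧ s4fX k i j d g t = (t : ℤ) - 4 * k + 3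
          ∧ s4fY k i j d g t = -3) ∨
      (4 * k + 2 * i + 2 * j + 3 ≤ t ∧ t ≤ 4 * k + 2 * i + 2 * j + 2 * d + 5 ∧ s4fX k i j d g t = (t : ℤ) - 4 * k
          + 2 ∧ s4fY k i j d g t = -2) ∨
      (4 * k + 2 * i + 2 * j + 2 * d + 6 ≤ t ∧ t + 2 * g + 2 ≤ 6 * k ∧ s4fX k i j d g t = (t : ℤ) - 4 * k + 1
          ∧ s4fY k i j d g t = -3) ∨
      (6 * k ≤ t + 2 * g + 1 ∧ t ≤ 6 * k ∧ s4fX k i j d g t = (t : ℤ) - 4 * k ∧ s4fY k i j d g t = -2) ∨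
      (6 * k + 1 ≤ t ∧ t ≤ 6 * k + 2 ∧ s4fX k i j d g t = (t : ℤ) - 4 * k - 1 ∧ s4fY k i j d g t = -1) ∨
      (6 * k + 3 ≤ t ∧ s4fX k i j d g t = (t : ℤ) - 4 * k - 2 ∧ s4fY k i j d g t = 0) := by
  simp only [s4fX, s4fY]
  split_ifs
  · exact Or.inl ⟨by omega, by omega, by omega⟩
  · exact Or.inr (Or.inl ⟨by omega, by omega, by omega, by omega⟩)
  · exact Or.inr (Or.inr (Or.inl ⟨by omega, by omega, by omega, by omega⟩))
  · exact Or.inr (Or.inr (Or.inr (Or.inl ⟨by omega, by omega, by omega, by omega⟩)))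
  · exact Or.inr (Or.inr (Or.inr (Or.inr (Or.inl ⟨by omega, by omega, by omega, by omega⟩))))
  · exact Or.inr (Or.inr (Or.inr (Or.inr (Or.inr (Or.inl ⟨by omega, by omega, by omega, by omega⟩)))))
  · exact Or.inr (Or.inr (Or.inr (Or.inr (Or.inr (Or.inr (Or.inl ⟨by omega, by omega, by omega, by omega⟩))))))
  · exact Or.inr (Or.inr (Or.inr (Or.inr (Or.inr (Or.inr (Or.inr (Or.inl ⟨by omega, by omega, by omega, by omega⟩)))))))
  · exact Or.inr (Or.inr (Or.inr (Or.inr (Or.inr (Or.inr (Or.inr (Or.inr (⟨by omega, by omega, by omega⟩))))))))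

/-- **Coordinate facts of `s4f`** (`i + j + d + g + 5 ≤ k`): brick-wall steps, self-avoidance, lower half-plane,
    columns in
`[0, X_L]` and `≥ 1` after time `0`, start and end on the wall, even length. [cite: EntingJensen2009, §7.4.2, Fig. 7.10]
[cite: MadrasSlade1993, §1.2, Definition 1.2.4 (bridges, p. 11)] -/
theorem s4f_facts {k i j d g : ℕ} (hs : i + j + d + g + 5 ≤ k) : Tab.Facts (6 * k
    + 4) (s4fX k i j d g) (s4fY k i j d g) := by
  refine ⟨fun t ht => ?_, fun t ht s hs hx hy => ?_, fun t ht => ?_, fun t ht => ?_, ?_, ?_, ?_, by omega,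
      fun t ht h1 => ?_⟩
  · rw [adjE_iff_fs]
    rcases s4f_cases k i j d g t with ⟨h, x, y⟩ | ⟨l, h, x, y⟩ | ⟨l, h, x, y⟩ | ⟨l, h, x, y⟩ | ⟨l, h, x, y⟩ | ⟨l, h,
        x, y⟩ | ⟨l, h, x, y⟩ | ⟨l, h, x, y⟩ | ⟨l, x, y⟩ <;>
      rcases s4f_cases k i j d g (t + 1) with ⟨h', x', y'⟩ | ⟨l', h', x', y'⟩ | ⟨l', h', x', y'⟩ | ⟨l', h', x',
          y'⟩ | ⟨l', h', x', y'⟩ | ⟨l', h', x', y'⟩ | ⟨l', h', x', y'⟩ | ⟨l', h', x', y'⟩ | ⟨l', x', y'⟩ <;>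
        omega
  · rcases s4f_cases k i j d g t with ⟨h, x, y⟩ | ⟨l, h, x, y⟩ | ⟨l, h, x, y⟩ | ⟨l, h, x, y⟩ | ⟨l, h, x, y⟩ | ⟨l, h,
      x, y⟩ | ⟨l, h, x, y⟩ | ⟨l, h, x, y⟩ | ⟨l, x, y⟩ <;>
      rcases s4f_cases k i j d g s with ⟨h', x', y'⟩ | ⟨l', h', x', y'⟩ | ⟨l', h', x', y'⟩ | ⟨l', h', x', y'⟩ | ⟨l',
          h', x', y'⟩ | ⟨l', h', x', y'⟩ | ⟨l', h', x', y'⟩ | ⟨l', h', x', y'⟩ | ⟨l', x', y'⟩ <;>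
        omega
  · rcases s4f_cases k i j d g t with ⟨h, x, y⟩ | ⟨l, h, x, y⟩ | ⟨l, h, x, y⟩ | ⟨l, h, x, y⟩ | ⟨l, h, x, y⟩ | ⟨l, h,
      x, y⟩ | ⟨l, h, x, y⟩ | ⟨l, h, x, y⟩ | ⟨l, x, y⟩ <;> omega
  · have h0 := s4f_cases k i j d g 0
    have hL := s4f_cases k i j d g (6 * k + 4)
    rcases s4f_cases k i j d g t with ⟨h, x, y⟩ | ⟨l, h, x, y⟩ | ⟨l, h, x, y⟩ | ⟨l, h, x, y⟩ | ⟨l, h, x, y⟩ | ⟨l, h,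
        x, y⟩ | ⟨l, h, x, y⟩ | ⟨l, h, x, y⟩ | ⟨l, x, y⟩ <;> omega
  · have h0 := s4f_cases k i j d g 0; omega
  · have h0 := s4f_cases k i j d g 0; omega
  · have hL := s4f_cases k i j d g (6 * k + 4); omega
  · rcases s4f_cases k i j d g t with ⟨h, x, y⟩ | ⟨l, h, x, y⟩ | ⟨l, h, x, y⟩ | ⟨l, h, x, y⟩ | ⟨l, h, x, y⟩ | ⟨l, h,
      x, y⟩ | ⟨l, h, x, y⟩ | ⟨l, h, x, y⟩ | ⟨l, x, y⟩ <;> omega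

/-- `s4f` is a positive wall bridge of length `m = 6k + 4` (length symbolic). [cite: MadrasSlade1993, §1.2,
    Definition 1.2.4 (p. 11)]
[cite: EntingJensen2009, §7.4.2, Fig. 7.10] -/
theorem s4f_mem_pwb {k i j d g m : ℕ} (hs : i + j + d + g + 5 ≤ k) (hm : m = 6 * k + 4) : s4f k i j d g ∈ pwb m :=
  mem_pwb_of_facts rfl (s4f_facts hs) hm

/-- Coordinates of `s4f` up to its length. [cite: EntingJensen2009, §7.4.2, Fig. 7.10] -/
theorem s4f_apply {k i j d g t : ℕ} (ht : t ≤ 6 * k + 4) : s4f k i j d g t 0 = s4fX k i j d g t ∧ s4f k i j d g t 1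
    = s4fY k i j d g t :=
  tab_walk_apply ht

/-- **`s4f` is irreducible**: the interior visits (all on the initial wall run) are followed by the return to column
    `2`; the final wall run is a single step. [cite: MadrasSlade1993, §4.2, Definition 4.2.1 (p. 90)]
[cite: Kesten1963SAW, §4] [cite: EntingJensen2009, §7.4.2, Fig. 7.10] -/
theorem s4f_mem_ipwb {k i j d g m : ℕ} (hs : i + j + d + g + 5 ≤ k) (hm : m = 6 * k + 4) : s4f k i j d g ∈ ipwb m := by
  refine mem_ipwb_of_facts_wit rfl (s4f_facts hs) hm (by omega) fun t ht1 ht2 hte hY => ?_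
  rcases s4f_cases k i j d g t with ⟨h, x, y⟩ | ⟨l, h, x, y⟩ | ⟨l, h, x, y⟩ | ⟨l, h, x, y⟩ | ⟨l, h, x, y⟩ | ⟨l, h, x,
      y⟩ | ⟨l, h, x, y⟩ | ⟨l, h, x, y⟩ | ⟨l, x, y⟩
  · refine Or.inl ⟨4 * k - 3, by omega, by omega, ?_⟩
    rcases s4f_cases k i j d g (4 * k - 3) with ⟨h', x', y'⟩ | ⟨l', h', x', y'⟩ | ⟨l', h', x', y'⟩ | ⟨l', h', x',
        y'⟩ | ⟨l', h', x', y'⟩ | ⟨l', h', x', y'⟩ | ⟨l', h', x', y'⟩ | ⟨l', h', x', y'⟩ | ⟨l', x', y'⟩ <;>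
      omega
  · omega
  · omega
  · omega
  · omega
  · omega
  · omega
  · omega
  · omega

/-- **`s4f` has `k` visits** (`k − 1` on the initial wall run and the endpoint).
[cite: BeatonBousquetMelouDeGierDuminilCopinGuttmann2014, §3.1 (arXiv v5 p. 8)] [cite: EntingJensen2009, §7.4.2,
    Fig. 7.10] -/
theorem visits_s4f {k i j d g m : ℕ} (hs : i + j + d + g + 5 ≤ k) (hm : m = 6 * k + 4) : visits m (s4f k i j d g)
    = k := by
  have hY : ∀ t, t ≤ 6 * k + 4 → s4f k i j d g t 1 = s4fY k i j d g t := fun t ht => (s4f_apply ht).2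
  have h1 : visits (0 + (2 * k - 1)) (s4f k i j d g) = visits (0) (s4f k i j d g) + ((0 + (2 * k - 1)) / 2 - (0) / 2) :=
    visits_add_of_wall fun q _ hq => by
      rw [hY _ (by omega)]
      rcases s4f_cases k i j d g (0 + q) with ⟨h', x', y'⟩ | ⟨l', h', x', y'⟩ | ⟨l', h', x', y'⟩ | ⟨l', h', x',
          y'⟩ | ⟨l', h', x', y'⟩ | ⟨l', h', x', y'⟩ | ⟨l', h', x', y'⟩ | ⟨l', h', x', y'⟩ | ⟨l', x', y'⟩ <;>
        omega
  have h2 : visits (2 * k - 1 + (4 * k + 3)) (s4f k i j d g) = visits (2 * k - 1) (s4f k i j d g) :=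
    visits_add_eq_left fun q hq1 hq2 h => by
      obtain ⟨-, h0⟩ := h
      rw [hY _ (by omega)] at h0
      rcases s4f_cases k i j d g (2 * k - 1 + q) with ⟨h', x', y'⟩ | ⟨l', h', x', y'⟩ | ⟨l', h', x', y'⟩ | ⟨l', h',
          x', y'⟩ | ⟨l', h', x', y'⟩ | ⟨l', h', x', y'⟩ | ⟨l', h', x', y'⟩ | ⟨l', h', x', y'⟩ | ⟨l', x', y'⟩ <;> omega
  have h3 : visits (6 * k + 2 + (2)) (s4f k i j d g) = visits (6 * k + 2) (s4f k i j d g) + ((6 * k + 2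
      + (2)) / 2 - (6 * k + 2) / 2) :=
    visits_add_of_wall fun q _ hq => by
      rw [hY _ (by omega)]
      rcases s4f_cases k i j d g (6 * k + 2 + q) with ⟨h', x', y'⟩ | ⟨l', h', x', y'⟩ | ⟨l', h', x', y'⟩ | ⟨l', h',
          x', y'⟩ | ⟨l', h', x', y'⟩ | ⟨l', h', x', y'⟩ | ⟨l', h', x', y'⟩ | ⟨l', h', x', y'⟩ | ⟨l', x', y'⟩ <;>
        omega
  rw [zero_add, visits_zero, zero_add] at h1
  rw [show 2 * k - 1 + (4 * k + 3) = 6 * k + 2 by omega, h1] at h2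
  rw [show 6 * k + 2 + (2) = 6 * k + 4 by omega, h2] at h3
  subst hm
  rw [h3]
  omega

/-- **`s4f` has four down steps**, at the times `2 * k - 1`, `4 * k - 3`, `4 * k + 2 * i - 1`, `4 * k + 2 * i
    + 2 * j + 2 * d + 5`. [cite: EntingJensen2009, §7.4.2, Fig. 7.10] -/
theorem stepsD_s4f {k i j d g m : ℕ} (hs : i + j + d + g + 5 ≤ k) (hm : m = 6 * k + 4) :
    stepsD m (s4f k i j d g) = {2 * k - 1, 4 * k - 3, 4 * k + 2 * i - 1, 4 * k + 2 * i + 2 * j + 2 * d + 5} := by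
  subst hm
  ext t
  simp only [stepsD, mem_filter, mem_range, mem_insert, mem_singleton]
  constructor
  · rintro ⟨ht, hx, hy⟩
    rw [(s4f_apply (t := t + 1) (by omega)).1, (s4f_apply (t := t) (by omega)).1] at hx
    rw [(s4f_apply (t := t + 1) (by omega)).2, (s4f_apply (t := t) (by omega)).2] at hy
    rcases s4f_cases k i j d g t with ⟨h, x, y⟩ | ⟨l, h, x, y⟩ | ⟨l, h, x, y⟩ | ⟨l, h, x, y⟩ | ⟨l, h, x, y⟩ | ⟨l, h,
        x, y⟩ | ⟨l, h, x, y⟩ | ⟨l, h, x, y⟩ | ⟨l, x, y⟩ <;>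
      rcases s4f_cases k i j d g (t + 1) with ⟨h', x', y'⟩ | ⟨l', h', x', y'⟩ | ⟨l', h', x', y'⟩ | ⟨l', h', x',
          y'⟩ | ⟨l', h', x', y'⟩ | ⟨l', h', x', y'⟩ | ⟨l', h', x', y'⟩ | ⟨l', h', x', y'⟩ | ⟨l', x', y'⟩ <;>
        omega
  · intro ht
    have ht4 : t + 1 ≤ 6 * k + 4 := by omega
    refine ⟨by omega, ?_, ?_⟩
    · rw [(s4f_apply ht4).1, (s4f_apply (t := t) (by omega)).1]
      rcases s4f_cases k i j d g t with ⟨h, x, y⟩ | ⟨l, h, x, y⟩ | ⟨l, h, x, y⟩ | ⟨l, h, x, y⟩ | ⟨l, h, x, y⟩ | ⟨l,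
          h, x, y⟩ | ⟨l, h, x, y⟩ | ⟨l, h, x, y⟩ | ⟨l, x, y⟩ <;>
        rcases s4f_cases k i j d g (t + 1) with ⟨h', x', y'⟩ | ⟨l', h', x', y'⟩ | ⟨l', h', x', y'⟩ | ⟨l', h', x',
            y'⟩ | ⟨l', h', x', y'⟩ | ⟨l', h', x', y'⟩ | ⟨l', h', x', y'⟩ | ⟨l', h', x', y'⟩ | ⟨l', x', y'⟩ <;>
          omega
    · rw [(s4f_apply ht4).2, (s4f_apply (t := t) (by omega)).2]
      rcases s4f_cases k i j d g t with ⟨h, x, y⟩ | ⟨l, h, x, y⟩ | ⟨l, h, x, y⟩ | ⟨l, h, x, y⟩ | ⟨l, h, x, y⟩ | ⟨l,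
          h, x, y⟩ | ⟨l, h, x, y⟩ | ⟨l, h, x, y⟩ | ⟨l, x, y⟩ <;>
        rcases s4f_cases k i j d g (t + 1) with ⟨h', x', y'⟩ | ⟨l', h', x', y'⟩ | ⟨l', h', x', y'⟩ | ⟨l', h', x',
            y'⟩ | ⟨l', h', x', y'⟩ | ⟨l', h', x', y'⟩ | ⟨l', h', x', y'⟩ | ⟨l', h', x', y'⟩ | ⟨l', x', y'⟩ <;>
          omega

/-- **`s4f` has four up steps**, at the times `4 * k + 2 * i + 2 * j + 2`, `6 * k - 2 * g - 2`, `6 * k`, `6 * k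
    + 2`. [cite: EntingJensen2009, §7.4.2, Fig. 7.10] -/
theorem stepsU_s4f {k i j d g m : ℕ} (hs : i + j + d + g + 5 ≤ k) (hm : m = 6 * k + 4) :
    stepsU m (s4f k i j d g) = {4 * k + 2 * i + 2 * j + 2, 6 * k - 2 * g - 2, 6 * k, 6 * k + 2} := by
  subst hm
  ext t
  simp only [stepsU, mem_filter, mem_range, mem_insert, mem_singleton]
  constructor
  · rintro ⟨ht, hx, hy⟩
    rw [(s4f_apply (t := t + 1) (by omega)).1, (s4f_apply (t := t) (by omega)).1] at hx
    rw [(s4f_apply (t := t + 1) (by omega)).2, (s4f_apply (t := t) (by omega)).2] at hy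
    rcases s4f_cases k i j d g t with ⟨h, x, y⟩ | ⟨l, h, x, y⟩ | ⟨l, h, x, y⟩ | ⟨l, h, x, y⟩ | ⟨l, h, x, y⟩ | ⟨l, h,
        x, y⟩ | ⟨l, h, x, y⟩ | ⟨l, h, x, y⟩ | ⟨l, x, y⟩ <;>
      rcases s4f_cases k i j d g (t + 1) with ⟨h', x', y'⟩ | ⟨l', h', x', y'⟩ | ⟨l', h', x', y'⟩ | ⟨l', h', x',
          y'⟩ | ⟨l', h', x', y'⟩ | ⟨l', h', x', y'⟩ | ⟨l', h', x', y'⟩ | ⟨l', h', x', y'⟩ | ⟨l', x', y'⟩ <;>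
        omega
  · intro ht
    have ht4 : t + 1 ≤ 6 * k + 4 := by omega
    refine ⟨by omega, ?_, ?_⟩
    · rw [(s4f_apply ht4).1, (s4f_apply (t := t) (by omega)).1]
      rcases s4f_cases k i j d g t with ⟨h, x, y⟩ | ⟨l, h, x, y⟩ | ⟨l, h, x, y⟩ | ⟨l, h, x, y⟩ | ⟨l, h, x, y⟩ | ⟨l,
          h, x, y⟩ | ⟨l, h, x, y⟩ | ⟨l, h, x, y⟩ | ⟨l, x, y⟩ <;>
        rcases s4f_cases k i j d g (t + 1) with ⟨h', x', y'⟩ | ⟨l', h', x', y'⟩ | ⟨l', h', x', y'⟩ | ⟨l', h', x',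
            y'⟩ | ⟨l', h', x', y'⟩ | ⟨l', h', x', y'⟩ | ⟨l', h', x', y'⟩ | ⟨l', h', x', y'⟩ | ⟨l', x', y'⟩ <;>
          omega
    · rw [(s4f_apply ht4).2, (s4f_apply (t := t) (by omega)).2]
      rcases s4f_cases k i j d g t with ⟨h, x, y⟩ | ⟨l, h, x, y⟩ | ⟨l, h, x, y⟩ | ⟨l, h, x, y⟩ | ⟨l, h, x, y⟩ | ⟨l,
          h, x, y⟩ | ⟨l, h, x, y⟩ | ⟨l, h, x, y⟩ | ⟨l, x, y⟩ <;>
        rcases s4f_cases k i j d g (t + 1) with ⟨h', x', y'⟩ | ⟨l', h', x', y'⟩ | ⟨l', h', x', y'⟩ | ⟨l', h', x',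
            y'⟩ | ⟨l', h', x', y'⟩ | ⟨l', h', x', y'⟩ | ⟨l', h', x', y'⟩ | ⟨l', h', x', y'⟩ | ⟨l', x', y'⟩ <;>
          omega


/-! ### §3  Family A13 (`D D D U U D U U`, hairpin opening, bottom exit,
    a dip on the way back): `R^{2a+1} D L^{2a−1} D R^{2i+1} D R^{2k−2i−2} U L^{2d+1} U L^{2e+2} D L^{2g+2} U
    L^{2k−2a−2d−2e−2g−7} U R^{2k−2a−1}` -/

/-- Column table of the s4g blocks (length `6k + 4`, vertical profile `D D D U U D U U`),
    9 affine pieces on the rows `0, −1, −2, −3, −2, −1, −2, −1, 0` (values `(t : ℤ)`, `-(t : ℤ) + 4 * a + 3`,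
    `(t : ℤ) - 4 * a`, `(t : ℤ) - 4 * a - 1`, `-(t : ℤ) + 4 * k + 4 * a + 4`, `-(t : ℤ) + 4 * k + 4 * a + 5`,
    `-(t : ℤ) + 4 * k + 4 * a + 6`, `-(t : ℤ) + 4 * k + 4 * a + 7`,
    `(t : ℤ) - 4 * k - 2` on the successive pieces). [cite: EntingJensen2009, §7.4.2,
    Fig. 7.10 (brickwork form of the honeycomb lattice)] -/
def s4gX (k a i d e g t : ℕ) : ℤ :=
  if t ≤ 2 * a + 1 then (t : ℤ)
  else if t ≤ 4 * a + 1 then -(t : ℤ) + 4 * a + 3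
  else if t ≤ 4 * a + 2 * i + 3 then (t : ℤ) - 4 * a
  else if t ≤ 2 * k + 4 * a + 2 then (t : ℤ) - 4 * a - 1
  else if t ≤ 2 * k + 4 * a + 2 * d + 4 then -(t : ℤ) + 4 * k + 4 * a + 4
  else if t ≤ 2 * k + 4 * a + 2 * d + 2 * e + 7 then -(t : ℤ) + 4 * k + 4 * a + 5
  else if t ≤ 2 * k + 4 * a + 2 * d + 2 * e + 2 * g + 10 then -(t : ℤ) + 4 * k + 4 * a + 6
  else if t ≤ 4 * k + 2 * a + 4 then -(t : ℤ) + 4 * k + 4 * a + 7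
  else (t : ℤ) - 4 * k - 2

/-- Height table of the s4g blocks: `0, −1, −2, −3, −2, −1, −2, −1, 0` on the 9 pieces. [cite: EntingJensen2009,
    §7.4.2, Fig. 7.10] -/
def s4gY (k a i d e g t : ℕ) : ℤ :=
  if t ≤ 2 * a + 1 then 0
  else if t ≤ 4 * a + 1 then -1
  else if t ≤ 4 * a + 2 * i + 3 then -2
  else if t ≤ 2 * k + 4 * a + 2 then -3
  else if t ≤ 2 * k + 4 * a + 2 * d + 4 then -2
  else if t ≤ 2 * k + 4 * a + 2 * d + 2 * e + 7 then -1
  else if t ≤ 2 * k + 4 * a + 2 * d + 2 * e + 2 * g + 10 then -2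
  else if t ≤ 4 * k + 2 * a + 4 then -1
  else 0

/-- **The A13 block** `(0,0)→…→(2a+1,0)↓←…←(2,−1)↓(2,−2)→…↓→…→(2k+1,−3)↑←…↑←…↓←…↑←…←(2a+3,−1)↑(2a+3,0)→…→(2k+2,0)` of
    length `6k+4`. [cite: EntingJensen2009, §7.4.2, Fig. 7.10] -/
def s4g (k a i d e g : ℕ) : ℕ → Site 2 := Tab.walk (6 * k + 4) (s4gX k a i d e g) (s4gY k a i d e g)

/-- The affine pieces of the tables of `s4g`, with their values. [cite: EntingJensen2009, §7.4.2, Fig. 7.10] -/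
private theorem s4g_cases (k a i d e g t : ℕ) :
    (t ≤ 2 * a + 1 ∧ s4gX k a i d e g t = (t : ℤ) ∧ s4gY k a i d e g t = 0) ∨
      (2 * a + 2 ≤ t ∧ t ≤ 4 * a + 1 ∧ s4gX k a i d e g t = -(t : ℤ) + 4 * a + 3 ∧ s4gY k a i d e g t = -1) ∨
      (4 * a + 2 ≤ t ∧ t ≤ 4 * a + 2 * i + 3 ∧ s4gX k a i d e g t = (t : ℤ) - 4 * a ∧ s4gY k a i d e g t = -2) ∨
      (4 * a + 2 * i + 4 ≤ t ∧ t ≤ 2 * k + 4 * a + 2 ∧ s4gX k a i d e g t = (t : ℤ) - 4 * a - 1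
          ∧ s4gY k a i d e g t = -3) ∨
      (2 * k + 4 * a + 3 ≤ t ∧ t ≤ 2 * k + 4 * a + 2 * d + 4 ∧ s4gX k a i d e g t = -(t : ℤ) + 4 * k + 4 * a + 4
          ∧ s4gY k a i d e g t = -2) ∨
      (2 * k + 4 * a + 2 * d + 5 ≤ t ∧ t ≤ 2 * k + 4 * a + 2 * d + 2 * e + 7 ∧ s4gX k a i d e g t = -(t : ℤ)
          + 4 * k + 4 * a + 5 ∧ s4gY k a i d e g t = -1) ∨
      (2 * k + 4 * a + 2 * d + 2 * e + 8 ≤ t ∧ t ≤ 2 * k + 4 * a + 2 * d + 2 * e + 2 * g + 10 ∧ s4gX k a i d e g t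
          = -(t : ℤ) + 4 * k + 4 * a + 6 ∧ s4gY k a i d e g t = -2) ∨
      (2 * k + 4 * a + 2 * d + 2 * e + 2 * g + 11 ≤ t ∧ t ≤ 4 * k + 2 * a + 4 ∧ s4gX k a i d e g t = -(t : ℤ)
          + 4 * k + 4 * a + 7 ∧ s4gY k a i d e g t = -1) ∨
      (4 * k + 2 * a + 5 ≤ t ∧ s4gX k a i d e g t = (t : ℤ) - 4 * k - 2 ∧ s4gY k a i d e g t = 0) := by
  simp only [s4gX, s4gY]
  split_ifs
  · exact Or.inl ⟨by omega, by omega, by omega⟩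
  · exact Or.inr (Or.inl ⟨by omega, by omega, by omega, by omega⟩)
  · exact Or.inr (Or.inr (Or.inl ⟨by omega, by omega, by omega, by omega⟩))
  · exact Or.inr (Or.inr (Or.inr (Or.inl ⟨by omega, by omega, by omega, by omega⟩)))
  · exact Or.inr (Or.inr (Or.inr (Or.inr (Or.inl ⟨by omega, by omega, by omega, by omega⟩))))
  · exact Or.inr (Or.inr (Or.inr (Or.inr (Or.inr (Or.inl ⟨by omega, by omega, by omega, by omega⟩)))))
  · exact Or.inr (Or.inr (Or.inr (Or.inr (Or.inr (Or.inr (Or.inl ⟨by omega, by omega, by omega, by omega⟩))))))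
  · exact Or.inr (Or.inr (Or.inr (Or.inr (Or.inr (Or.inr (Or.inr (Or.inl ⟨by omega, by omega, by omega, by omega⟩)))))))
  · exact Or.inr (Or.inr (Or.inr (Or.inr (Or.inr (Or.inr (Or.inr (Or.inr (⟨by omega, by omega, by omega⟩))))))))

/-- **Coordinate facts of `s4g`** (`1 ≤ a`, `a + d + e + g + 4 ≤ k`, `i + d + e + g + 4 ≤ k`): brick-wall steps,
    self-avoidance, lower half-plane, columns in
`[0, X_L]` and `≥ 1` after time `0`, start and end on the wall, even length. [cite: EntingJensen2009, §7.4.2, Fig. 7.10]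
[cite: MadrasSlade1993, §1.2, Definition 1.2.4 (bridges, p. 11)] -/
theorem s4g_facts {k a i d e g : ℕ} (ha : 1 ≤ a) (hs : a + d + e + g + 4 ≤ k) (hi : i + d + e + g + 4
    ≤ k) : Tab.Facts (6 * k + 4) (s4gX k a i d e g) (s4gY k a i d e g) := by
  refine ⟨fun t ht => ?_, fun t ht s hs hx hy => ?_, fun t ht => ?_, fun t ht => ?_, ?_, ?_, ?_, by omega,
      fun t ht h1 => ?_⟩
  · rw [adjE_iff_fs]
    rcases s4g_cases k a i d e g t with ⟨h, x, y⟩ | ⟨l, h, x, y⟩ | ⟨l, h, x, y⟩ | ⟨l, h, x, y⟩ | ⟨l, h, x, y⟩ | ⟨l,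
        h, x, y⟩ | ⟨l, h, x, y⟩ | ⟨l, h, x, y⟩ | ⟨l, x, y⟩ <;>
      rcases s4g_cases k a i d e g (t + 1) with ⟨h', x', y'⟩ | ⟨l', h', x', y'⟩ | ⟨l', h', x', y'⟩ | ⟨l', h', x',
          y'⟩ | ⟨l', h', x', y'⟩ | ⟨l', h', x', y'⟩ | ⟨l', h', x', y'⟩ | ⟨l', h', x', y'⟩ | ⟨l', x', y'⟩ <;>
        omega
  · rcases s4g_cases k a i d e g t with ⟨h, x, y⟩ | ⟨l, h, x, y⟩ | ⟨l, h, x, y⟩ | ⟨l, h, x, y⟩ | ⟨l, h, x, y⟩ | ⟨l,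
      h, x, y⟩ | ⟨l, h, x, y⟩ | ⟨l, h, x, y⟩ | ⟨l, x, y⟩ <;>
      rcases s4g_cases k a i d e g s with ⟨h', x', y'⟩ | ⟨l', h', x', y'⟩ | ⟨l', h', x', y'⟩ | ⟨l', h', x',
          y'⟩ | ⟨l', h', x', y'⟩ | ⟨l', h', x', y'⟩ | ⟨l', h', x', y'⟩ | ⟨l', h', x', y'⟩ | ⟨l', x', y'⟩ <;>
        omega
  · rcases s4g_cases k a i d e g t with ⟨h, x, y⟩ | ⟨l, h, x, y⟩ | ⟨l, h, x, y⟩ | ⟨l, h, x, y⟩ | ⟨l, h, x, y⟩ | ⟨l,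
      h, x, y⟩ | ⟨l, h, x, y⟩ | ⟨l, h, x, y⟩ | ⟨l, x, y⟩ <;> omega
  · have h0 := s4g_cases k a i d e g 0
    have hL := s4g_cases k a i d e g (6 * k + 4)
    rcases s4g_cases k a i d e g t with ⟨h, x, y⟩ | ⟨l, h, x, y⟩ | ⟨l, h, x, y⟩ | ⟨l, h, x, y⟩ | ⟨l, h, x, y⟩ | ⟨l,
        h, x, y⟩ | ⟨l, h, x, y⟩ | ⟨l, h, x, y⟩ | ⟨l, x, y⟩ <;> omega
  · have h0 := s4g_cases k a i d e g 0; omega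
  · have h0 := s4g_cases k a i d e g 0; omega
  · have hL := s4g_cases k a i d e g (6 * k + 4); omega
  · rcases s4g_cases k a i d e g t with ⟨h, x, y⟩ | ⟨l, h, x, y⟩ | ⟨l, h, x, y⟩ | ⟨l, h, x, y⟩ | ⟨l, h, x, y⟩ | ⟨l,
      h, x, y⟩ | ⟨l, h, x, y⟩ | ⟨l, h, x, y⟩ | ⟨l, x, y⟩ <;> omega

/-- `s4g` is a positive wall bridge of length `m = 6k + 4` (length symbolic). [cite: MadrasSlade1993, §1.2,
    Definition 1.2.4 (p. 11)]
[cite: EntingJensen2009, §7.4.2, Fig. 7.10] -/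
theorem s4g_mem_pwb {k a i d e g m : ℕ} (ha : 1 ≤ a) (hs : a + d + e + g + 4 ≤ k) (hi : i + d + e + g + 4
    ≤ k) (hm : m = 6 * k + 4) : s4g k a i d e g ∈ pwb m :=
  mem_pwb_of_facts rfl (s4g_facts ha hs hi) hm

/-- Coordinates of `s4g` up to its length. [cite: EntingJensen2009, §7.4.2, Fig. 7.10] -/
theorem s4g_apply {k a i d e g t : ℕ} (ht : t ≤ 6 * k + 4) : s4g k a i d e g t 0 = s4gX k a i d e g t
    ∧ s4g k a i d e g t 1 = s4gY k a i d e g t :=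
  tab_walk_apply ht

/-- **`s4g` is irreducible**: the interior visits of the initial wall run are followed by the return to column `2`,
    those of the final wall run (columns `≤ 2k`) are preceded by the bottom exit column `2k+1` (row `−3`). [cite:
    MadrasSlade1993, §4.2, Definition 4.2.1 (p. 90)]
[cite: Kesten1963SAW, §4] [cite: EntingJensen2009, §7.4.2, Fig. 7.10] -/
theorem s4g_mem_ipwb {k a i d e g m : ℕ} (ha : 1 ≤ a) (hs : a + d + e + g + 4 ≤ k) (hi : i + d + e + g + 4
    ≤ k) (hm : m = 6 * k + 4) : s4g k a i d e g ∈ ipwb m := by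
  refine mem_ipwb_of_facts_wit rfl (s4g_facts ha hs hi) hm (by omega) fun t ht1 ht2 hte hY => ?_
  rcases s4g_cases k a i d e g t with ⟨h, x, y⟩ | ⟨l, h, x, y⟩ | ⟨l, h, x, y⟩ | ⟨l, h, x, y⟩ | ⟨l, h, x, y⟩ | ⟨l, h,
      x, y⟩ | ⟨l, h, x, y⟩ | ⟨l, h, x, y⟩ | ⟨l, x, y⟩
  · refine Or.inl ⟨4 * a + 1, by omega, by omega, ?_⟩
    rcases s4g_cases k a i d e g (4 * a + 1) with ⟨h', x', y'⟩ | ⟨l', h', x', y'⟩ | ⟨l', h', x', y'⟩ | ⟨l', h', x',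
        y'⟩ | ⟨l', h', x', y'⟩ | ⟨l', h', x', y'⟩ | ⟨l', h', x', y'⟩ | ⟨l', h', x', y'⟩ | ⟨l', x', y'⟩ <;>
      omega
  · omega
  · omega
  · omega
  · omega
  · omega
  · omega
  · omega
  · refine Or.inr ⟨2 * k + 4 * a + 2, by omega, by omega, ?_⟩
    rcases s4g_cases k a i d e g (2 * k + 4 * a + 2) with ⟨h', x', y'⟩ | ⟨l', h', x', y'⟩ | ⟨l', h', x', y'⟩ | ⟨l',
        h', x', y'⟩ | ⟨l', h', x', y'⟩ | ⟨l', h', x', y'⟩ | ⟨l', h', x', y'⟩ | ⟨l', h', x', y'⟩ | ⟨l', x', y'⟩ <;>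
      omega

/-- **`s4g` has `k` visits** (`a` on the initial wall run, `k − a` on the final one).
[cite: BeatonBousquetMelouDeGierDuminilCopinGuttmann2014, §3.1 (arXiv v5 p. 8)] [cite: EntingJensen2009, §7.4.2,
    Fig. 7.10] -/
theorem visits_s4g {k a i d e g m : ℕ} (ha : 1 ≤ a) (hs : a + d + e + g + 4 ≤ k) (hi : i + d + e + g + 4
    ≤ k) (hm : m = 6 * k + 4) : visits m (s4g k a i d e g) = k := by
  have hY : ∀ t, t ≤ 6 * k + 4 → s4g k a i d e g t 1 = s4gY k a i d e g t := fun t ht => (s4g_apply ht).2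
  have h1 : visits (0 + (2 * a + 1)) (s4g k a i d e g) = visits (0) (s4g k a i d e g) + ((0 + (2 * a
      + 1)) / 2 - (0) / 2) :=
    visits_add_of_wall fun q _ hq => by
      rw [hY _ (by omega)]
      rcases s4g_cases k a i d e g (0 + q) with ⟨h', x', y'⟩ | ⟨l', h', x', y'⟩ | ⟨l', h', x', y'⟩ | ⟨l', h', x',
          y'⟩ | ⟨l', h', x', y'⟩ | ⟨l', h', x', y'⟩ | ⟨l', h', x', y'⟩ | ⟨l', h', x', y'⟩ | ⟨l', x', y'⟩ <;>
        omega
  have h2 : visits (2 * a + 1 + (4 * k + 3)) (s4g k a i d e g) = visits (2 * a + 1) (s4g k a i d e g) :=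
    visits_add_eq_left fun q hq1 hq2 h => by
      obtain ⟨-, h0⟩ := h
      rw [hY _ (by omega)] at h0
      rcases s4g_cases k a i d e g (2 * a + 1 + q) with ⟨h', x', y'⟩ | ⟨l', h', x', y'⟩ | ⟨l', h', x', y'⟩ | ⟨l', h',
          x', y'⟩ | ⟨l', h', x', y'⟩ | ⟨l', h', x', y'⟩ | ⟨l', h', x', y'⟩ | ⟨l', h', x', y'⟩ | ⟨l', x', y'⟩ <;> omega
  have h3 : visits (4 * k + 2 * a + 4 + (2 * k - 2 * a)) (s4g k a i d e g) = visits (4 * k + 2 * a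
      + 4) (s4g k a i d e g) + ((4 * k + 2 * a + 4 + (2 * k - 2 * a)) / 2 - (4 * k + 2 * a + 4) / 2) :=
    visits_add_of_wall fun q _ hq => by
      rw [hY _ (by omega)]
      rcases s4g_cases k a i d e g (4 * k + 2 * a + 4 + q) with ⟨h', x', y'⟩ | ⟨l', h', x', y'⟩ | ⟨l', h', x',
          y'⟩ | ⟨l', h', x', y'⟩ | ⟨l', h', x', y'⟩ | ⟨l', h', x', y'⟩ | ⟨l', h', x', y'⟩ | ⟨l', h', x', y'⟩ | ⟨l',
          x', y'⟩ <;>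
        omega
  rw [zero_add, visits_zero, zero_add] at h1
  rw [show 2 * a + 1 + (4 * k + 3) = 4 * k + 2 * a + 4 by omega, h1] at h2
  rw [show 4 * k + 2 * a + 4 + (2 * k - 2 * a) = 6 * k + 4 by omega, h2] at h3
  subst hm
  rw [h3]
  omega

/-- **`s4g` has four down steps**, at the times `2 * a + 1`, `4 * a + 1`, `4 * a + 2 * i + 3`, `2 * k + 4 * a
    + 2 * d + 2 * e + 7`. [cite: EntingJensen2009, §7.4.2, Fig. 7.10] -/
theorem stepsD_s4g {k a i d e g m : ℕ} (ha : 1 ≤ a) (hs : a + d + e + g + 4 ≤ k) (hi : i + d + e + g + 4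
    ≤ k) (hm : m = 6 * k + 4) :
    stepsD m (s4g k a i d e g) = {2 * a + 1, 4 * a + 1, 4 * a + 2 * i + 3, 2 * k + 4 * a + 2 * d + 2 * e + 7} := by
  subst hm
  ext t
  simp only [stepsD, mem_filter, mem_range, mem_insert, mem_singleton]
  constructor
  · rintro ⟨ht, hx, hy⟩
    rw [(s4g_apply (t := t + 1) (by omega)).1, (s4g_apply (t := t) (by omega)).1] at hx
    rw [(s4g_apply (t := t + 1) (by omega)).2, (s4g_apply (t := t) (by omega)).2] at hy
    rcases s4g_cases k a i d e g t with ⟨h, x, y⟩ | ⟨l, h, x, y⟩ | ⟨l, h, x, y⟩ | ⟨l, h, x, y⟩ | ⟨l, h, x, y⟩ | ⟨l,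
        h, x, y⟩ | ⟨l, h, x, y⟩ | ⟨l, h, x, y⟩ | ⟨l, x, y⟩ <;>
      rcases s4g_cases k a i d e g (t + 1) with ⟨h', x', y'⟩ | ⟨l', h', x', y'⟩ | ⟨l', h', x', y'⟩ | ⟨l', h', x',
          y'⟩ | ⟨l', h', x', y'⟩ | ⟨l', h', x', y'⟩ | ⟨l', h', x', y'⟩ | ⟨l', h', x', y'⟩ | ⟨l', x', y'⟩ <;>
        omega
  · intro ht
    have ht4 : t + 1 ≤ 6 * k + 4 := by omega
    refine ⟨by omega, ?_, ?_⟩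
    · rw [(s4g_apply ht4).1, (s4g_apply (t := t) (by omega)).1]
      rcases s4g_cases k a i d e g t with ⟨h, x, y⟩ | ⟨l, h, x, y⟩ | ⟨l, h, x, y⟩ | ⟨l, h, x, y⟩ | ⟨l, h, x, y⟩ | ⟨l,
          h, x, y⟩ | ⟨l, h, x, y⟩ | ⟨l, h, x, y⟩ | ⟨l, x, y⟩ <;>
        rcases s4g_cases k a i d e g (t + 1) with ⟨h', x', y'⟩ | ⟨l', h', x', y'⟩ | ⟨l', h', x', y'⟩ | ⟨l', h', x',
            y'⟩ | ⟨l', h', x', y'⟩ | ⟨l', h', x', y'⟩ | ⟨l', h', x', y'⟩ | ⟨l', h', x', y'⟩ | ⟨l', x', y'⟩ <;>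
          omega
    · rw [(s4g_apply ht4).2, (s4g_apply (t := t) (by omega)).2]
      rcases s4g_cases k a i d e g t with ⟨h, x, y⟩ | ⟨l, h, x, y⟩ | ⟨l, h, x, y⟩ | ⟨l, h, x, y⟩ | ⟨l, h, x, y⟩ | ⟨l,
          h, x, y⟩ | ⟨l, h, x, y⟩ | ⟨l, h, x, y⟩ | ⟨l, x, y⟩ <;>
        rcases s4g_cases k a i d e g (t + 1) with ⟨h', x', y'⟩ | ⟨l', h', x', y'⟩ | ⟨l', h', x', y'⟩ | ⟨l', h', x',
            y'⟩ | ⟨l', h', x', y'⟩ | ⟨l', h', x', y'⟩ | ⟨l', h', x', y'⟩ | ⟨l', h', x', y'⟩ | ⟨l', x', y'⟩ <;>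
          omega

/-- **`s4g` has four up steps**, at the times `2 * k + 4 * a + 2`, `2 * k + 4 * a + 2 * d + 4`, `2 * k + 4 * a
    + 2 * d + 2 * e + 2 * g + 10`, `4 * k + 2 * a + 4`. [cite: EntingJensen2009, §7.4.2, Fig. 7.10] -/
theorem stepsU_s4g {k a i d e g m : ℕ} (ha : 1 ≤ a) (hs : a + d + e + g + 4 ≤ k) (hi : i + d + e + g + 4
    ≤ k) (hm : m = 6 * k + 4) :
    stepsU m (s4g k a i d e g) = {2 * k + 4 * a + 2, 2 * k + 4 * a + 2 * d + 4, 2 * k + 4 * a + 2 * d + 2 * e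
        + 2 * g + 10, 4 * k + 2 * a + 4} := by
  subst hm
  ext t
  simp only [stepsU, mem_filter, mem_range, mem_insert, mem_singleton]
  constructor
  · rintro ⟨ht, hx, hy⟩
    rw [(s4g_apply (t := t + 1) (by omega)).1, (s4g_apply (t := t) (by omega)).1] at hx
    rw [(s4g_apply (t := t + 1) (by omega)).2, (s4g_apply (t := t) (by omega)).2] at hy
    rcases s4g_cases k a i d e g t with ⟨h, x, y⟩ | ⟨l, h, x, y⟩ | ⟨l, h, x, y⟩ | ⟨l, h, x, y⟩ | ⟨l, h, x, y⟩ | ⟨l,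
        h, x, y⟩ | ⟨l, h, x, y⟩ | ⟨l, h, x, y⟩ | ⟨l, x, y⟩ <;>
      rcases s4g_cases k a i d e g (t + 1) with ⟨h', x', y'⟩ | ⟨l', h', x', y'⟩ | ⟨l', h', x', y'⟩ | ⟨l', h', x',
          y'⟩ | ⟨l', h', x', y'⟩ | ⟨l', h', x', y'⟩ | ⟨l', h', x', y'⟩ | ⟨l', h', x', y'⟩ | ⟨l', x', y'⟩ <;>
        omega
  · intro ht
    have ht4 : t + 1 ≤ 6 * k + 4 := by omega
    refine ⟨by omega, ?_, ?_⟩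
    · rw [(s4g_apply ht4).1, (s4g_apply (t := t) (by omega)).1]
      rcases s4g_cases k a i d e g t with ⟨h, x, y⟩ | ⟨l, h, x, y⟩ | ⟨l, h, x, y⟩ | ⟨l, h, x, y⟩ | ⟨l, h, x, y⟩ | ⟨l,
          h, x, y⟩ | ⟨l, h, x, y⟩ | ⟨l, h, x, y⟩ | ⟨l, x, y⟩ <;>
        rcases s4g_cases k a i d e g (t + 1) with ⟨h', x', y'⟩ | ⟨l', h', x', y'⟩ | ⟨l', h', x', y'⟩ | ⟨l', h', x',
            y'⟩ | ⟨l', h', x', y'⟩ | ⟨l', h', x', y'⟩ | ⟨l', h', x', y'⟩ | ⟨l', h', x', y'⟩ | ⟨l', x', y'⟩ <;>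
          omega
    · rw [(s4g_apply ht4).2, (s4g_apply (t := t) (by omega)).2]
      rcases s4g_cases k a i d e g t with ⟨h, x, y⟩ | ⟨l, h, x, y⟩ | ⟨l, h, x, y⟩ | ⟨l, h, x, y⟩ | ⟨l, h, x, y⟩ | ⟨l,
          h, x, y⟩ | ⟨l, h, x, y⟩ | ⟨l, h, x, y⟩ | ⟨l, x, y⟩ <;>
        rcases s4g_cases k a i d e g (t + 1) with ⟨h', x', y'⟩ | ⟨l', h', x', y'⟩ | ⟨l', h', x', y'⟩ | ⟨l', h', x',
            y'⟩ | ⟨l', h', x', y'⟩ | ⟨l', h', x', y'⟩ | ⟨l', h', x', y'⟩ | ⟨l', h', x', y'⟩ | ⟨l', x', y'⟩ <;>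
          omega


/-! ### §4  Family A14 (`D D U D D U U U`, a dip on the way down to column `2`,
    bottom exit): `R^{2a+1} D L^{2i+1} D L^{2j+2} U L^{2a−2i−2j−4} D R^{2d+1} D R^{2k−2d−2} U L^{2g+1} U
    L^{2k−2a−2g−3} U R^{2k−2a−1}` -/

/-- Column table of the s4h blocks (length `6k + 4`, vertical profile `D D U D D U U U`),
    9 affine pieces on the rows `0, −1, −2, −1, −2, −3, −2, −1, 0` (values `(t : ℤ)`, `-(t : ℤ) + 4 * a + 3`,
    `-(t : ℤ) + 4 * a + 4`, `-(t : ℤ) + 4 * a + 5`, `(t : ℤ) - 4 * a - 2`, `(t : ℤ) - 4 * a - 3`, `-(t : ℤ) + 4 * k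
    + 4 * a + 6`, `-(t : ℤ) + 4 * k + 4 * a + 7`,
    `(t : ℤ) - 4 * k - 2` on the successive pieces). [cite: EntingJensen2009, §7.4.2,
    Fig. 7.10 (brickwork form of the honeycomb lattice)] -/
def s4hX (k a i j d g t : ℕ) : ℤ :=
  if t ≤ 2 * a + 1 then (t : ℤ)
  else if t ≤ 2 * a + 2 * i + 3 then -(t : ℤ) + 4 * a + 3
  else if t ≤ 2 * a + 2 * i + 2 * j + 6 then -(t : ℤ) + 4 * a + 4
  else if t ≤ 4 * a + 3 then -(t : ℤ) + 4 * a + 5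
  else if t ≤ 4 * a + 2 * d + 5 then (t : ℤ) - 4 * a - 2
  else if t ≤ 2 * k + 4 * a + 4 then (t : ℤ) - 4 * a - 3
  else if t ≤ 2 * k + 4 * a + 2 * g + 6 then -(t : ℤ) + 4 * k + 4 * a + 6
  else if t ≤ 4 * k + 2 * a + 4 then -(t : ℤ) + 4 * k + 4 * a + 7
  else (t : ℤ) - 4 * k - 2

/-- Height table of the s4h blocks: `0, −1, −2, −1, −2, −3, −2, −1, 0` on the 9 pieces. [cite: EntingJensen2009,
    §7.4.2, Fig. 7.10] -/
def s4hY (k a i j d g t : ℕ) : ℤ :=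
  if t ≤ 2 * a + 1 then 0
  else if t ≤ 2 * a + 2 * i + 3 then -1
  else if t ≤ 2 * a + 2 * i + 2 * j + 6 then -2
  else if t ≤ 4 * a + 3 then -1
  else if t ≤ 4 * a + 2 * d + 5 then -2
  else if t ≤ 2 * k + 4 * a + 4 then -3
  else if t ≤ 2 * k + 4 * a + 2 * g + 6 then -2
  else if t ≤ 4 * k + 2 * a + 4 then -1
  else 0

/-- **The A14 block** `(0,0)→…→(2a+1,0)↓←…↓←…↑←…←(2,−1)↓(2,−2)→…↓→…→(2k+1,−3)↑←…↑←…←(2a+3,−1)↑(2a+3,0)→…→(2k+2,0)` of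
    length `6k+4`. [cite: EntingJensen2009, §7.4.2, Fig. 7.10] -/
def s4h (k a i j d g : ℕ) : ℕ → Site 2 := Tab.walk (6 * k + 4) (s4hX k a i j d g) (s4hY k a i j d g)

/-- The affine pieces of the tables of `s4h`, with their values. [cite: EntingJensen2009, §7.4.2, Fig. 7.10] -/
private theorem s4h_cases (k a i j d g t : ℕ) :
    (t ≤ 2 * a + 1 ∧ s4hX k a i j d g t = (t : ℤ) ∧ s4hY k a i j d g t = 0) ∨
      (2 * a + 2 ≤ t ∧ t ≤ 2 * a + 2 * i + 3 ∧ s4hX k a i j d g t = -(t : ℤ) + 4 * a + 3 ∧ s4hY k a i j d g t = -1) ∨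
      (2 * a + 2 * i + 4 ≤ t ∧ t ≤ 2 * a + 2 * i + 2 * j + 6 ∧ s4hX k a i j d g t = -(t : ℤ) + 4 * a + 4
          ∧ s4hY k a i j d g t = -2) ∨
      (2 * a + 2 * i + 2 * j + 7 ≤ t ∧ t ≤ 4 * a + 3 ∧ s4hX k a i j d g t = -(t : ℤ) + 4 * a + 5
          ∧ s4hY k a i j d g t = -1) ∨
      (4 * a + 4 ≤ t ∧ t ≤ 4 * a + 2 * d + 5 ∧ s4hX k a i j d g t = (t : ℤ) - 4 * a - 2 ∧ s4hY k a i j d g t = -2) ∨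
      (4 * a + 2 * d + 6 ≤ t ∧ t ≤ 2 * k + 4 * a + 4 ∧ s4hX k a i j d g t = (t : ℤ) - 4 * a - 3
          ∧ s4hY k a i j d g t = -3) ∨
      (2 * k + 4 * a + 5 ≤ t ∧ t ≤ 2 * k + 4 * a + 2 * g + 6 ∧ s4hX k a i j d g t = -(t : ℤ) + 4 * k + 4 * a + 6
          ∧ s4hY k a i j d g t = -2) ∨
      (2 * k + 4 * a + 2 * g + 7 ≤ t ∧ t ≤ 4 * k + 2 * a + 4 ∧ s4hX k a i j d g t = -(t : ℤ) + 4 * k + 4 * a + 7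
          ∧ s4hY k a i j d g t = -1) ∨
      (4 * k + 2 * a + 5 ≤ t ∧ s4hX k a i j d g t = (t : ℤ) - 4 * k - 2 ∧ s4hY k a i j d g t = 0) := by
  simp only [s4hX, s4hY]
  split_ifs
  · exact Or.inl ⟨by omega, by omega, by omega⟩
  · exact Or.inr (Or.inl ⟨by omega, by omega, by omega, by omega⟩)
  · exact Or.inr (Or.inr (Or.inl ⟨by omega, by omega, by omega, by omega⟩))
  · exact Or.inr (Or.inr (Or.inr (Or.inl ⟨by omega, by omega, by omega, by omega⟩)))
  · exact Or.inr (Or.inr (Or.inr (Or.inr (Or.inl ⟨by omega, by omega, by omega, by omega⟩))))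
  · exact Or.inr (Or.inr (Or.inr (Or.inr (Or.inr (Or.inl ⟨by omega, by omega, by omega, by omega⟩)))))
  · exact Or.inr (Or.inr (Or.inr (Or.inr (Or.inr (Or.inr (Or.inl ⟨by omega, by omega, by omega, by omega⟩))))))
  · exact Or.inr (Or.inr (Or.inr (Or.inr (Or.inr (Or.inr (Or.inr (Or.inl ⟨by omega, by omega, by omega, by omega⟩)))))))
  · exact Or.inr (Or.inr (Or.inr (Or.inr (Or.inr (Or.inr (Or.inr (Or.inr (⟨by omega, by omega, by omega⟩))))))))

/-- **Coordinate facts of `s4h`** (`i + j + d + 3 ≤ a`, `a + g + 2 ≤ k`): brick-wall steps, self-avoidance,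
    lower half-plane, columns in
`[0, X_L]` and `≥ 1` after time `0`, start and end on the wall, even length. [cite: EntingJensen2009, §7.4.2, Fig. 7.10]
[cite: MadrasSlade1993, §1.2, Definition 1.2.4 (bridges, p. 11)] -/
theorem s4h_facts {k a i j d g : ℕ} (hd : i + j + d + 3 ≤ a) (hga : a + g + 2 ≤ k) : Tab.Facts (6 * k
    + 4) (s4hX k a i j d g) (s4hY k a i j d g) := by
  refine ⟨fun t ht => ?_, fun t ht s hs hx hy => ?_, fun t ht => ?_, fun t ht => ?_, ?_, ?_, ?_, by omega,
      fun t ht h1 => ?_⟩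
  · rw [adjE_iff_fs]
    rcases s4h_cases k a i j d g t with ⟨h, x, y⟩ | ⟨l, h, x, y⟩ | ⟨l, h, x, y⟩ | ⟨l, h, x, y⟩ | ⟨l, h, x, y⟩ | ⟨l,
        h, x, y⟩ | ⟨l, h, x, y⟩ | ⟨l, h, x, y⟩ | ⟨l, x, y⟩ <;>
      rcases s4h_cases k a i j d g (t + 1) with ⟨h', x', y'⟩ | ⟨l', h', x', y'⟩ | ⟨l', h', x', y'⟩ | ⟨l', h', x',
          y'⟩ | ⟨l', h', x', y'⟩ | ⟨l', h', x', y'⟩ | ⟨l', h', x', y'⟩ | ⟨l', h', x', y'⟩ | ⟨l', x', y'⟩ <;>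
        omega
  · rcases s4h_cases k a i j d g t with ⟨h, x, y⟩ | ⟨l, h, x, y⟩ | ⟨l, h, x, y⟩ | ⟨l, h, x, y⟩ | ⟨l, h, x, y⟩ | ⟨l,
      h, x, y⟩ | ⟨l, h, x, y⟩ | ⟨l, h, x, y⟩ | ⟨l, x, y⟩ <;>
      rcases s4h_cases k a i j d g s with ⟨h', x', y'⟩ | ⟨l', h', x', y'⟩ | ⟨l', h', x', y'⟩ | ⟨l', h', x',
          y'⟩ | ⟨l', h', x', y'⟩ | ⟨l', h', x', y'⟩ | ⟨l', h', x', y'⟩ | ⟨l', h', x', y'⟩ | ⟨l', x', y'⟩ <;>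
        omega
  · rcases s4h_cases k a i j d g t with ⟨h, x, y⟩ | ⟨l, h, x, y⟩ | ⟨l, h, x, y⟩ | ⟨l, h, x, y⟩ | ⟨l, h, x, y⟩ | ⟨l,
      h, x, y⟩ | ⟨l, h, x, y⟩ | ⟨l, h, x, y⟩ | ⟨l, x, y⟩ <;> omega
  · have h0 := s4h_cases k a i j d g 0
    have hL := s4h_cases k a i j d g (6 * k + 4)
    rcases s4h_cases k a i j d g t with ⟨h, x, y⟩ | ⟨l, h, x, y⟩ | ⟨l, h, x, y⟩ | ⟨l, h, x, y⟩ | ⟨l, h, x, y⟩ | ⟨l,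
        h, x, y⟩ | ⟨l, h, x, y⟩ | ⟨l, h, x, y⟩ | ⟨l, x, y⟩ <;> omega
  · have h0 := s4h_cases k a i j d g 0; omega
  · have h0 := s4h_cases k a i j d g 0; omega
  · have hL := s4h_cases k a i j d g (6 * k + 4); omega
  · rcases s4h_cases k a i j d g t with ⟨h, x, y⟩ | ⟨l, h, x, y⟩ | ⟨l, h, x, y⟩ | ⟨l, h, x, y⟩ | ⟨l, h, x, y⟩ | ⟨l,
      h, x, y⟩ | ⟨l, h, x, y⟩ | ⟨l, h, x, y⟩ | ⟨l, x, y⟩ <;> omega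

/-- `s4h` is a positive wall bridge of length `m = 6k + 4` (length symbolic). [cite: MadrasSlade1993, §1.2,
    Definition 1.2.4 (p. 11)]
[cite: EntingJensen2009, §7.4.2, Fig. 7.10] -/
theorem s4h_mem_pwb {k a i j d g m : ℕ} (hd : i + j + d + 3 ≤ a) (hga : a + g + 2 ≤ k) (hm : m = 6 * k
    + 4) : s4h k a i j d g ∈ pwb m :=
  mem_pwb_of_facts rfl (s4h_facts hd hga) hm

/-- Coordinates of `s4h` up to its length. [cite: EntingJensen2009, §7.4.2, Fig. 7.10] -/
theorem s4h_apply {k a i j d g t : ℕ} (ht : t ≤ 6 * k + 4) : s4h k a i j d g t 0 = s4hX k a i j d g t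
    ∧ s4h k a i j d g t 1 = s4hY k a i j d g t :=
  tab_walk_apply ht

/-- **`s4h` is irreducible**: the interior visits of the initial wall run are followed by the body's column `2` (row
    `−1`), those of the final wall run (columns `≤ 2k`) are preceded by the bottom exit column `2k+1` (row `−3`).
    [cite: MadrasSlade1993, §4.2, Definition 4.2.1 (p. 90)]
[cite: Kesten1963SAW, §4] [cite: EntingJensen2009, §7.4.2, Fig. 7.10] -/
theorem s4h_mem_ipwb {k a i j d g m : ℕ} (hd : i + j + d + 3 ≤ a) (hga : a + g + 2 ≤ k) (hm : m = 6 * k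
    + 4) : s4h k a i j d g ∈ ipwb m := by
  refine mem_ipwb_of_facts_wit rfl (s4h_facts hd hga) hm (by omega) fun t ht1 ht2 hte hY => ?_
  rcases s4h_cases k a i j d g t with ⟨h, x, y⟩ | ⟨l, h, x, y⟩ | ⟨l, h, x, y⟩ | ⟨l, h, x, y⟩ | ⟨l, h, x, y⟩ | ⟨l, h,
      x, y⟩ | ⟨l, h, x, y⟩ | ⟨l, h, x, y⟩ | ⟨l, x, y⟩
  · refine Or.inl ⟨4 * a + 3, by omega, by omega, ?_⟩
    rcases s4h_cases k a i j d g (4 * a + 3) with ⟨h', x', y'⟩ | ⟨l', h', x', y'⟩ | ⟨l', h', x', y'⟩ | ⟨l', h', x',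
        y'⟩ | ⟨l', h', x', y'⟩ | ⟨l', h', x', y'⟩ | ⟨l', h', x', y'⟩ | ⟨l', h', x', y'⟩ | ⟨l', x', y'⟩ <;>
      omega
  · omega
  · omega
  · omega
  · omega
  · omega
  · omega
  · omega
  · refine Or.inr ⟨2 * k + 4 * a + 4, by omega, by omega, ?_⟩
    rcases s4h_cases k a i j d g (2 * k + 4 * a + 4) with ⟨h', x', y'⟩ | ⟨l', h', x', y'⟩ | ⟨l', h', x', y'⟩ | ⟨l',
        h', x', y'⟩ | ⟨l', h', x', y'⟩ | ⟨l', h', x', y'⟩ | ⟨l', h', x', y'⟩ | ⟨l', h', x', y'⟩ | ⟨l', x', y'⟩ <;>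
      omega

/-- **`s4h` has `k` visits** (`a` on the initial wall run, `k − a` on the final one).
[cite: BeatonBousquetMelouDeGierDuminilCopinGuttmann2014, §3.1 (arXiv v5 p. 8)] [cite: EntingJensen2009, §7.4.2,
    Fig. 7.10] -/
theorem visits_s4h {k a i j d g m : ℕ} (hd : i + j + d + 3 ≤ a) (hga : a + g + 2 ≤ k) (hm : m = 6 * k
    + 4) : visits m (s4h k a i j d g) = k := by
  have hY : ∀ t, t ≤ 6 * k + 4 → s4h k a i j d g t 1 = s4hY k a i j d g t := fun t ht => (s4h_apply ht).2
  have h1 : visits (0 + (2 * a + 1)) (s4h k a i j d g) = visits (0) (s4h k a i j d g) + ((0 + (2 * a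
      + 1)) / 2 - (0) / 2) :=
    visits_add_of_wall fun q _ hq => by
      rw [hY _ (by omega)]
      rcases s4h_cases k a i j d g (0 + q) with ⟨h', x', y'⟩ | ⟨l', h', x', y'⟩ | ⟨l', h', x', y'⟩ | ⟨l', h', x',
          y'⟩ | ⟨l', h', x', y'⟩ | ⟨l', h', x', y'⟩ | ⟨l', h', x', y'⟩ | ⟨l', h', x', y'⟩ | ⟨l', x', y'⟩ <;>
        omega
  have h2 : visits (2 * a + 1 + (4 * k + 3)) (s4h k a i j d g) = visits (2 * a + 1) (s4h k a i j d g) :=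
    visits_add_eq_left fun q hq1 hq2 h => by
      obtain ⟨-, h0⟩ := h
      rw [hY _ (by omega)] at h0
      rcases s4h_cases k a i j d g (2 * a + 1 + q) with ⟨h', x', y'⟩ | ⟨l', h', x', y'⟩ | ⟨l', h', x', y'⟩ | ⟨l', h',
          x', y'⟩ | ⟨l', h', x', y'⟩ | ⟨l', h', x', y'⟩ | ⟨l', h', x', y'⟩ | ⟨l', h', x', y'⟩ | ⟨l', x', y'⟩ <;> omega
  have h3 : visits (4 * k + 2 * a + 4 + (2 * k - 2 * a)) (s4h k a i j d g) = visits (4 * k + 2 * a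
      + 4) (s4h k a i j d g) + ((4 * k + 2 * a + 4 + (2 * k - 2 * a)) / 2 - (4 * k + 2 * a + 4) / 2) :=
    visits_add_of_wall fun q _ hq => by
      rw [hY _ (by omega)]
      rcases s4h_cases k a i j d g (4 * k + 2 * a + 4 + q) with ⟨h', x', y'⟩ | ⟨l', h', x', y'⟩ | ⟨l', h', x',
          y'⟩ | ⟨l', h', x', y'⟩ | ⟨l', h', x', y'⟩ | ⟨l', h', x', y'⟩ | ⟨l', h', x', y'⟩ | ⟨l', h', x', y'⟩ | ⟨l',
          x', y'⟩ <;>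
        omega
  rw [zero_add, visits_zero, zero_add] at h1
  rw [show 2 * a + 1 + (4 * k + 3) = 4 * k + 2 * a + 4 by omega, h1] at h2
  rw [show 4 * k + 2 * a + 4 + (2 * k - 2 * a) = 6 * k + 4 by omega, h2] at h3
  subst hm
  rw [h3]
  omega

/-- **`s4h` has four down steps**, at the times `2 * a + 1`, `2 * a + 2 * i + 3`, `4 * a + 3`, `4 * a + 2 * d
    + 5`. [cite: EntingJensen2009, §7.4.2, Fig. 7.10] -/
theorem stepsD_s4h {k a i j d g m : ℕ} (hd : i + j + d + 3 ≤ a) (hga : a + g + 2 ≤ k) (hm : m = 6 * k + 4) :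
    stepsD m (s4h k a i j d g) = {2 * a + 1, 2 * a + 2 * i + 3, 4 * a + 3, 4 * a + 2 * d + 5} := by
  subst hm
  ext t
  simp only [stepsD, mem_filter, mem_range, mem_insert, mem_singleton]
  constructor
  · rintro ⟨ht, hx, hy⟩
    rw [(s4h_apply (t := t + 1) (by omega)).1, (s4h_apply (t := t) (by omega)).1] at hx
    rw [(s4h_apply (t := t + 1) (by omega)).2, (s4h_apply (t := t) (by omega)).2] at hy
    rcases s4h_cases k a i j d g t with ⟨h, x, y⟩ | ⟨l, h, x, y⟩ | ⟨l, h, x, y⟩ | ⟨l, h, x, y⟩ | ⟨l, h, x, y⟩ | ⟨l,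
        h, x, y⟩ | ⟨l, h, x, y⟩ | ⟨l, h, x, y⟩ | ⟨l, x, y⟩ <;>
      rcases s4h_cases k a i j d g (t + 1) with ⟨h', x', y'⟩ | ⟨l', h', x', y'⟩ | ⟨l', h', x', y'⟩ | ⟨l', h', x',
          y'⟩ | ⟨l', h', x', y'⟩ | ⟨l', h', x', y'⟩ | ⟨l', h', x', y'⟩ | ⟨l', h', x', y'⟩ | ⟨l', x', y'⟩ <;>
        omega
  · intro ht
    have ht4 : t + 1 ≤ 6 * k + 4 := by omega
    refine ⟨by omega, ?_, ?_⟩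
    · rw [(s4h_apply ht4).1, (s4h_apply (t := t) (by omega)).1]
      rcases s4h_cases k a i j d g t with ⟨h, x, y⟩ | ⟨l, h, x, y⟩ | ⟨l, h, x, y⟩ | ⟨l, h, x, y⟩ | ⟨l, h, x, y⟩ | ⟨l,
          h, x, y⟩ | ⟨l, h, x, y⟩ | ⟨l, h, x, y⟩ | ⟨l, x, y⟩ <;>
        rcases s4h_cases k a i j d g (t + 1) with ⟨h', x', y'⟩ | ⟨l', h', x', y'⟩ | ⟨l', h', x', y'⟩ | ⟨l', h', x',
            y'⟩ | ⟨l', h', x', y'⟩ | ⟨l', h', x', y'⟩ | ⟨l', h', x', y'⟩ | ⟨l', h', x', y'⟩ | ⟨l', x', y'⟩ <;>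
          omega
    · rw [(s4h_apply ht4).2, (s4h_apply (t := t) (by omega)).2]
      rcases s4h_cases k a i j d g t with ⟨h, x, y⟩ | ⟨l, h, x, y⟩ | ⟨l, h, x, y⟩ | ⟨l, h, x, y⟩ | ⟨l, h, x, y⟩ | ⟨l,
          h, x, y⟩ | ⟨l, h, x, y⟩ | ⟨l, h, x, y⟩ | ⟨l, x, y⟩ <;>
        rcases s4h_cases k a i j d g (t + 1) with ⟨h', x', y'⟩ | ⟨l', h', x', y'⟩ | ⟨l', h', x', y'⟩ | ⟨l', h', x',
            y'⟩ | ⟨l', h', x', y'⟩ | ⟨l', h', x', y'⟩ | ⟨l', h', x', y'⟩ | ⟨l', h', x', y'⟩ | ⟨l', x', y'⟩ <;>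
          omega

/-- **`s4h` has four up steps**, at the times `2 * a + 2 * i + 2 * j + 6`, `2 * k + 4 * a + 4`, `2 * k + 4 * a
    + 2 * g + 6`, `4 * k + 2 * a + 4`. [cite: EntingJensen2009, §7.4.2, Fig. 7.10] -/
theorem stepsU_s4h {k a i j d g m : ℕ} (hd : i + j + d + 3 ≤ a) (hga : a + g + 2 ≤ k) (hm : m = 6 * k + 4) :
    stepsU m (s4h k a i j d g) = {2 * a + 2 * i + 2 * j + 6, 2 * k + 4 * a + 4, 2 * k + 4 * a + 2 * g + 6, 4 * k
        + 2 * a + 4} := by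
  subst hm
  ext t
  simp only [stepsU, mem_filter, mem_range, mem_insert, mem_singleton]
  constructor
  · rintro ⟨ht, hx, hy⟩
    rw [(s4h_apply (t := t + 1) (by omega)).1, (s4h_apply (t := t) (by omega)).1] at hx
    rw [(s4h_apply (t := t + 1) (by omega)).2, (s4h_apply (t := t) (by omega)).2] at hy
    rcases s4h_cases k a i j d g t with ⟨h, x, y⟩ | ⟨l, h, x, y⟩ | ⟨l, h, x, y⟩ | ⟨l, h, x, y⟩ | ⟨l, h, x, y⟩ | ⟨l,
        h, x, y⟩ | ⟨l, h, x, y⟩ | ⟨l, h, x, y⟩ | ⟨l, x, y⟩ <;>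
      rcases s4h_cases k a i j d g (t + 1) with ⟨h', x', y'⟩ | ⟨l', h', x', y'⟩ | ⟨l', h', x', y'⟩ | ⟨l', h', x',
          y'⟩ | ⟨l', h', x', y'⟩ | ⟨l', h', x', y'⟩ | ⟨l', h', x', y'⟩ | ⟨l', h', x', y'⟩ | ⟨l', x', y'⟩ <;>
        omega
  · intro ht
    have ht4 : t + 1 ≤ 6 * k + 4 := by omega
    refine ⟨by omega, ?_, ?_⟩
    · rw [(s4h_apply ht4).1, (s4h_apply (t := t) (by omega)).1]
      rcases s4h_cases k a i j d g t with ⟨h, x, y⟩ | ⟨l, h, x, y⟩ | ⟨l, h, x, y⟩ | ⟨l, h, x, y⟩ | ⟨l, h, x, y⟩ | ⟨l,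
          h, x, y⟩ | ⟨l, h, x, y⟩ | ⟨l, h, x, y⟩ | ⟨l, x, y⟩ <;>
        rcases s4h_cases k a i j d g (t + 1) with ⟨h', x', y'⟩ | ⟨l', h', x', y'⟩ | ⟨l', h', x', y'⟩ | ⟨l', h', x',
            y'⟩ | ⟨l', h', x', y'⟩ | ⟨l', h', x', y'⟩ | ⟨l', h', x', y'⟩ | ⟨l', h', x', y'⟩ | ⟨l', x', y'⟩ <;>
          omega
    · rw [(s4h_apply ht4).2, (s4h_apply (t := t) (by omega)).2]
      rcases s4h_cases k a i j d g t with ⟨h, x, y⟩ | ⟨l, h, x, y⟩ | ⟨l, h, x, y⟩ | ⟨l, h, x, y⟩ | ⟨l, h, x, y⟩ | ⟨l,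
          h, x, y⟩ | ⟨l, h, x, y⟩ | ⟨l, h, x, y⟩ | ⟨l, x, y⟩ <;>
        rcases s4h_cases k a i j d g (t + 1) with ⟨h', x', y'⟩ | ⟨l', h', x', y'⟩ | ⟨l', h', x', y'⟩ | ⟨l', h', x',
            y'⟩ | ⟨l', h', x', y'⟩ | ⟨l', h', x', y'⟩ | ⟨l', h', x', y'⟩ | ⟨l', h', x', y'⟩ | ⟨l', x', y'⟩ <;>
          omega


/-! ### §5  Family A15 (`D D U D D U U U`, wall run of length `2k−1`, a dip on the way down to column `2`,
    staircase exit): `R^{2k−1} D L^{2i+1} D L^{2j+2} U L^{2k−2i−2j−6} D R^{2d+1} D R^{2k−2d−2g−4} U R^{2g+1} U R U R` -/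

/-- Column table of the s4i blocks (length `6k + 4`, vertical profile `D D U D D U U U`),
    9 affine pieces on the rows `0, −1, −2, −1, −2, −3, −2, −1, 0` (values `(t : ℤ)`, `-(t : ℤ) + 4 * k - 1`,
    `-(t : ℤ) + 4 * k`, `-(t : ℤ) + 4 * k + 1`, `(t : ℤ) - 4 * k + 2`, `(t : ℤ) - 4 * k + 1`, `(t : ℤ) - 4 * k`,
    `(t : ℤ) - 4 * k - 1`, `(t : ℤ) - 4 * k - 2` on the successive pieces). [cite: EntingJensen2009, §7.4.2,
    Fig. 7.10 (brickwork form of the honeycomb lattice)] -/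
def s4iX (k i j d g t : ℕ) : ℤ :=
  if t + 1 ≤ 2 * k then (t : ℤ)
  else if t ≤ 2 * k + 2 * i + 1 then -(t : ℤ) + 4 * k - 1
  else if t ≤ 2 * k + 2 * i + 2 * j + 4 then -(t : ℤ) + 4 * k
  else if t + 1 ≤ 4 * k then -(t : ℤ) + 4 * k + 1
  else if t ≤ 4 * k + 2 * d + 1 then (t : ℤ) - 4 * k + 2
  else if t + 2 * g + 2 ≤ 6 * k then (t : ℤ) - 4 * k + 1
  else if t ≤ 6 * k then (t : ℤ) - 4 * k
  else if t ≤ 6 * k + 2 then (t : ℤ) - 4 * k - 1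
  else (t : ℤ) - 4 * k - 2

/-- Height table of the s4i blocks: `0, −1, −2, −1, −2, −3, −2, −1, 0` on the 9 pieces. [cite: EntingJensen2009,
    §7.4.2, Fig. 7.10] -/
def s4iY (k i j d g t : ℕ) : ℤ :=
  if t + 1 ≤ 2 * k then 0
  else if t ≤ 2 * k + 2 * i + 1 then -1
  else if t ≤ 2 * k + 2 * i + 2 * j + 4 then -2
  else if t + 1 ≤ 4 * k then -1
  else if t ≤ 4 * k + 2 * d + 1 then -2
  else if t + 2 * g + 2 ≤ 6 * k then -3
  else if t ≤ 6 * k then -2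
  else if t ≤ 6 * k + 2 then -1
  else 0

/-- **The A15 block** `(0,0)→…→(2k−1,0)↓←…↓←…↑←…←(2,−1)↓(2,−2)→…↓→…↑→…→(2k,−2)↑(2k,−1)→(2k+1,−1)↑(2k+1,0)→(2k+2,0)`
    of length `6k+4`. [cite: EntingJensen2009, §7.4.2, Fig. 7.10] -/
def s4i (k i j d g : ℕ) : ℕ → Site 2 := Tab.walk (6 * k + 4) (s4iX k i j d g) (s4iY k i j d g)

/-- The affine pieces of the tables of `s4i`, with their values. [cite: EntingJensen2009, §7.4.2, Fig. 7.10] -/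
private theorem s4i_cases (k i j d g t : ℕ) :
    (t + 1 ≤ 2 * k ∧ s4iX k i j d g t = (t : ℤ) ∧ s4iY k i j d g t = 0) ∨
      (2 * k ≤ t ∧ t ≤ 2 * k + 2 * i + 1 ∧ s4iX k i j d g t = -(t : ℤ) + 4 * k - 1 ∧ s4iY k i j d g t = -1) ∨
      (2 * k + 2 * i + 2 ≤ t ∧ t ≤ 2 * k + 2 * i + 2 * j + 4 ∧ s4iX k i j d g t = -(t : ℤ) + 4 * k
          ∧ s4iY k i j d g t = -2) ∨
      (2 * k + 2 * i + 2 * j + 5 ≤ t ∧ t + 1 ≤ 4 * k ∧ s4iX k i j d g t = -(t : ℤ) + 4 * k + 1 ∧ s4iY k i j d g t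
          = -1) ∨
      (4 * k ≤ t ∧ t ≤ 4 * k + 2 * d + 1 ∧ s4iX k i j d g t = (t : ℤ) - 4 * k + 2 ∧ s4iY k i j d g t = -2) ∨
      (4 * k + 2 * d + 2 ≤ t ∧ t + 2 * g + 2 ≤ 6 * k ∧ s4iX k i j d g t = (t : ℤ) - 4 * k + 1 ∧ s4iY k i j d g t = -3) ∨
      (6 * k ≤ t + 2 * g + 1 ∧ t ≤ 6 * k ∧ s4iX k i j d g t = (t : ℤ) - 4 * k ∧ s4iY k i j d g t = -2) ∨
      (6 * k + 1 ≤ t ∧ t ≤ 6 * k + 2 ∧ s4iX k i j d g t = (t : ℤ) - 4 * k - 1 ∧ s4iY k i j d g t = -1) ∨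
      (6 * k + 3 ≤ t ∧ s4iX k i j d g t = (t : ℤ) - 4 * k - 2 ∧ s4iY k i j d g t = 0) := by
  simp only [s4iX, s4iY]
  split_ifs
  · exact Or.inl ⟨by omega, by omega, by omega⟩
  · exact Or.inr (Or.inl ⟨by omega, by omega, by omega, by omega⟩)
  · exact Or.inr (Or.inr (Or.inl ⟨by omega, by omega, by omega, by omega⟩))
  · exact Or.inr (Or.inr (Or.inr (Or.inl ⟨by omega, by omega, by omega, by omega⟩)))
  · exact Or.inr (Or.inr (Or.inr (Or.inr (Or.inl ⟨by omega, by omega, by omega, by omega⟩))))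
  · exact Or.inr (Or.inr (Or.inr (Or.inr (Or.inr (Or.inl ⟨by omega, by omega, by omega, by omega⟩)))))
  · exact Or.inr (Or.inr (Or.inr (Or.inr (Or.inr (Or.inr (Or.inl ⟨by omega, by omega, by omega, by omega⟩))))))
  · exact Or.inr (Or.inr (Or.inr (Or.inr (Or.inr (Or.inr (Or.inr (Or.inl ⟨by omega, by omega, by omega, by omega⟩)))))))
  · exact Or.inr (Or.inr (Or.inr (Or.inr (Or.inr (Or.inr (Or.inr (Or.inr (⟨by omega, by omega, by omega⟩))))))))

/-- **Coordinate facts of `s4i`** (`i + j + d + 4 ≤ k`, `g ≤ i`): brick-wall steps, self-avoidance, lower half-plane,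
    columns in
`[0, X_L]` and `≥ 1` after time `0`, start and end on the wall, even length. [cite: EntingJensen2009, §7.4.2, Fig. 7.10]
[cite: MadrasSlade1993, §1.2, Definition 1.2.4 (bridges, p. 11)] -/
theorem s4i_facts {k i j d g : ℕ} (hd : i + j + d + 4 ≤ k) (hgi : g ≤ i) : Tab.Facts (6 * k
    + 4) (s4iX k i j d g) (s4iY k i j d g) := by
  refine ⟨fun t ht => ?_, fun t ht s hs hx hy => ?_, fun t ht => ?_, fun t ht => ?_, ?_, ?_, ?_, by omega,
      fun t ht h1 => ?_⟩
  · rw [adjE_iff_fs]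
    rcases s4i_cases k i j d g t with ⟨h, x, y⟩ | ⟨l, h, x, y⟩ | ⟨l, h, x, y⟩ | ⟨l, h, x, y⟩ | ⟨l, h, x, y⟩ | ⟨l, h,
        x, y⟩ | ⟨l, h, x, y⟩ | ⟨l, h, x, y⟩ | ⟨l, x, y⟩ <;>
      rcases s4i_cases k i j d g (t + 1) with ⟨h', x', y'⟩ | ⟨l', h', x', y'⟩ | ⟨l', h', x', y'⟩ | ⟨l', h', x',
          y'⟩ | ⟨l', h', x', y'⟩ | ⟨l', h', x', y'⟩ | ⟨l', h', x', y'⟩ | ⟨l', h', x', y'⟩ | ⟨l', x', y'⟩ <;>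
        omega
  · rcases s4i_cases k i j d g t with ⟨h, x, y⟩ | ⟨l, h, x, y⟩ | ⟨l, h, x, y⟩ | ⟨l, h, x, y⟩ | ⟨l, h, x, y⟩ | ⟨l, h,
      x, y⟩ | ⟨l, h, x, y⟩ | ⟨l, h, x, y⟩ | ⟨l, x, y⟩ <;>
      rcases s4i_cases k i j d g s with ⟨h', x', y'⟩ | ⟨l', h', x', y'⟩ | ⟨l', h', x', y'⟩ | ⟨l', h', x', y'⟩ | ⟨l',
          h', x', y'⟩ | ⟨l', h', x', y'⟩ | ⟨l', h', x', y'⟩ | ⟨l', h', x', y'⟩ | ⟨l', x', y'⟩ <;>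
        omega
  · rcases s4i_cases k i j d g t with ⟨h, x, y⟩ | ⟨l, h, x, y⟩ | ⟨l, h, x, y⟩ | ⟨l, h, x, y⟩ | ⟨l, h, x, y⟩ | ⟨l, h,
      x, y⟩ | ⟨l, h, x, y⟩ | ⟨l, h, x, y⟩ | ⟨l, x, y⟩ <;> omega
  · have h0 := s4i_cases k i j d g 0
    have hL := s4i_cases k i j d g (6 * k + 4)
    rcases s4i_cases k i j d g t with ⟨h, x, y⟩ | ⟨l, h, x, y⟩ | ⟨l, h, x, y⟩ | ⟨l, h, x, y⟩ | ⟨l, h, x, y⟩ | ⟨l, h,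
        x, y⟩ | ⟨l, h, x, y⟩ | ⟨l, h, x, y⟩ | ⟨l, x, y⟩ <;> omega
  · have h0 := s4i_cases k i j d g 0; omega
  · have h0 := s4i_cases k i j d g 0; omega
  · have hL := s4i_cases k i j d g (6 * k + 4); omega
  · rcases s4i_cases k i j d g t with ⟨h, x, y⟩ | ⟨l, h, x, y⟩ | ⟨l, h, x, y⟩ | ⟨l, h, x, y⟩ | ⟨l, h, x, y⟩ | ⟨l, h,
      x, y⟩ | ⟨l, h, x, y⟩ | ⟨l, h, x, y⟩ | ⟨l, x, y⟩ <;> omega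

/-- `s4i` is a positive wall bridge of length `m = 6k + 4` (length symbolic). [cite: MadrasSlade1993, §1.2,
    Definition 1.2.4 (p. 11)]
[cite: EntingJensen2009, §7.4.2, Fig. 7.10] -/
theorem s4i_mem_pwb {k i j d g m : ℕ} (hd : i + j + d + 4 ≤ k) (hgi : g ≤ i) (hm : m = 6 * k
    + 4) : s4i k i j d g ∈ pwb m :=
  mem_pwb_of_facts rfl (s4i_facts hd hgi) hm

/-- Coordinates of `s4i` up to its length. [cite: EntingJensen2009, §7.4.2, Fig. 7.10] -/
theorem s4i_apply {k i j d g t : ℕ} (ht : t ≤ 6 * k + 4) : s4i k i j d g t 0 = s4iX k i j d g t ∧ s4i k i j d g t 1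
    = s4iY k i j d g t :=
  tab_walk_apply ht

/-- **`s4i` is irreducible**: the interior visits (all on the initial wall run) are followed by the body's column `2`
    (row `−1`); the final wall run is a single step. [cite: MadrasSlade1993, §4.2, Definition 4.2.1 (p. 90)]
[cite: Kesten1963SAW, §4] [cite: EntingJensen2009, §7.4.2, Fig. 7.10] -/
theorem s4i_mem_ipwb {k i j d g m : ℕ} (hd : i + j + d + 4 ≤ k) (hgi : g ≤ i) (hm : m = 6 * k
    + 4) : s4i k i j d g ∈ ipwb m := by
  refine mem_ipwb_of_facts_wit rfl (s4i_facts hd hgi) hm (by omega) fun t ht1 ht2 hte hY => ?_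
  rcases s4i_cases k i j d g t with ⟨h, x, y⟩ | ⟨l, h, x, y⟩ | ⟨l, h, x, y⟩ | ⟨l, h, x, y⟩ | ⟨l, h, x, y⟩ | ⟨l, h, x,
      y⟩ | ⟨l, h, x, y⟩ | ⟨l, h, x, y⟩ | ⟨l, x, y⟩
  · refine Or.inl ⟨4 * k - 1, by omega, by omega, ?_⟩
    rcases s4i_cases k i j d g (4 * k - 1) with ⟨h', x', y'⟩ | ⟨l', h', x', y'⟩ | ⟨l', h', x', y'⟩ | ⟨l', h', x',
        y'⟩ | ⟨l', h', x', y'⟩ | ⟨l', h', x', y'⟩ | ⟨l', h', x', y'⟩ | ⟨l', h', x', y'⟩ | ⟨l', x', y'⟩ <;>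
      omega
  · omega
  · omega
  · omega
  · omega
  · omega
  · omega
  · omega
  · omega

/-- **`s4i` has `k` visits** (`k − 1` on the initial wall run and the endpoint).
[cite: BeatonBousquetMelouDeGierDuminilCopinGuttmann2014, §3.1 (arXiv v5 p. 8)] [cite: EntingJensen2009, §7.4.2,
    Fig. 7.10] -/
theorem visits_s4i {k i j d g m : ℕ} (hd : i + j + d + 4 ≤ k) (hgi : g ≤ i) (hm : m = 6 * k
    + 4) : visits m (s4i k i j d g) = k := by
  have hY : ∀ t, t ≤ 6 * k + 4 → s4i k i j d g t 1 = s4iY k i j d g t := fun t ht => (s4i_apply ht).2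
  have h1 : visits (0 + (2 * k - 1)) (s4i k i j d g) = visits (0) (s4i k i j d g) + ((0 + (2 * k - 1)) / 2 - (0) / 2) :=
    visits_add_of_wall fun q _ hq => by
      rw [hY _ (by omega)]
      rcases s4i_cases k i j d g (0 + q) with ⟨h', x', y'⟩ | ⟨l', h', x', y'⟩ | ⟨l', h', x', y'⟩ | ⟨l', h', x',
          y'⟩ | ⟨l', h', x', y'⟩ | ⟨l', h', x', y'⟩ | ⟨l', h', x', y'⟩ | ⟨l', h', x', y'⟩ | ⟨l', x', y'⟩ <;>
        omega
  have h2 : visits (2 * k - 1 + (4 * k + 3)) (s4i k i j d g) = visits (2 * k - 1) (s4i k i j d g) :=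
    visits_add_eq_left fun q hq1 hq2 h => by
      obtain ⟨-, h0⟩ := h
      rw [hY _ (by omega)] at h0
      rcases s4i_cases k i j d g (2 * k - 1 + q) with ⟨h', x', y'⟩ | ⟨l', h', x', y'⟩ | ⟨l', h', x', y'⟩ | ⟨l', h',
          x', y'⟩ | ⟨l', h', x', y'⟩ | ⟨l', h', x', y'⟩ | ⟨l', h', x', y'⟩ | ⟨l', h', x', y'⟩ | ⟨l', x', y'⟩ <;> omega
  have h3 : visits (6 * k + 2 + (2)) (s4i k i j d g) = visits (6 * k + 2) (s4i k i j d g) + ((6 * k + 2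
      + (2)) / 2 - (6 * k + 2) / 2) :=
    visits_add_of_wall fun q _ hq => by
      rw [hY _ (by omega)]
      rcases s4i_cases k i j d g (6 * k + 2 + q) with ⟨h', x', y'⟩ | ⟨l', h', x', y'⟩ | ⟨l', h', x', y'⟩ | ⟨l', h',
          x', y'⟩ | ⟨l', h', x', y'⟩ | ⟨l', h', x', y'⟩ | ⟨l', h', x', y'⟩ | ⟨l', h', x', y'⟩ | ⟨l', x', y'⟩ <;>
        omega
  rw [zero_add, visits_zero, zero_add] at h1
  rw [show 2 * k - 1 + (4 * k + 3) = 6 * k + 2 by omega, h1] at h2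
  rw [show 6 * k + 2 + (2) = 6 * k + 4 by omega, h2] at h3
  subst hm
  rw [h3]
  omega

/-- **`s4i` has four down steps**, at the times `2 * k - 1`, `2 * k + 2 * i + 1`, `4 * k - 1`, `4 * k + 2 * d
    + 1`. [cite: EntingJensen2009, §7.4.2, Fig. 7.10] -/
theorem stepsD_s4i {k i j d g m : ℕ} (hd : i + j + d + 4 ≤ k) (hgi : g ≤ i) (hm : m = 6 * k + 4) :
    stepsD m (s4i k i j d g) = {2 * k - 1, 2 * k + 2 * i + 1, 4 * k - 1, 4 * k + 2 * d + 1} := by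
  subst hm
  ext t
  simp only [stepsD, mem_filter, mem_range, mem_insert, mem_singleton]
  constructor
  · rintro ⟨ht, hx, hy⟩
    rw [(s4i_apply (t := t + 1) (by omega)).1, (s4i_apply (t := t) (by omega)).1] at hx
    rw [(s4i_apply (t := t + 1) (by omega)).2, (s4i_apply (t := t) (by omega)).2] at hy
    rcases s4i_cases k i j d g t with ⟨h, x, y⟩ | ⟨l, h, x, y⟩ | ⟨l, h, x, y⟩ | ⟨l, h, x, y⟩ | ⟨l, h, x, y⟩ | ⟨l, h,
        x, y⟩ | ⟨l, h, x, y⟩ | ⟨l, h, x, y⟩ | ⟨l, x, y⟩ <;>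
      rcases s4i_cases k i j d g (t + 1) with ⟨h', x', y'⟩ | ⟨l', h', x', y'⟩ | ⟨l', h', x', y'⟩ | ⟨l', h', x',
          y'⟩ | ⟨l', h', x', y'⟩ | ⟨l', h', x', y'⟩ | ⟨l', h', x', y'⟩ | ⟨l', h', x', y'⟩ | ⟨l', x', y'⟩ <;>
        omega
  · intro ht
    have ht4 : t + 1 ≤ 6 * k + 4 := by omega
    refine ⟨by omega, ?_, ?_⟩
    · rw [(s4i_apply ht4).1, (s4i_apply (t := t) (by omega)).1]
      rcases s4i_cases k i j d g t with ⟨h, x, y⟩ | ⟨l, h, x, y⟩ | ⟨l, h, x, y⟩ | ⟨l, h, x, y⟩ | ⟨l, h, x, y⟩ | ⟨l,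
          h, x, y⟩ | ⟨l, h, x, y⟩ | ⟨l, h, x, y⟩ | ⟨l, x, y⟩ <;>
        rcases s4i_cases k i j d g (t + 1) with ⟨h', x', y'⟩ | ⟨l', h', x', y'⟩ | ⟨l', h', x', y'⟩ | ⟨l', h', x',
            y'⟩ | ⟨l', h', x', y'⟩ | ⟨l', h', x', y'⟩ | ⟨l', h', x', y'⟩ | ⟨l', h', x', y'⟩ | ⟨l', x', y'⟩ <;>
          omega
    · rw [(s4i_apply ht4).2, (s4i_apply (t := t) (by omega)).2]
      rcases s4i_cases k i j d g t with ⟨h, x, y⟩ | ⟨l, h, x, y⟩ | ⟨l, h, x, y⟩ | ⟨l, h, x, y⟩ | ⟨l, h, x, y⟩ | ⟨l,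
          h, x, y⟩ | ⟨l, h, x, y⟩ | ⟨l, h, x, y⟩ | ⟨l, x, y⟩ <;>
        rcases s4i_cases k i j d g (t + 1) with ⟨h', x', y'⟩ | ⟨l', h', x', y'⟩ | ⟨l', h', x', y'⟩ | ⟨l', h', x',
            y'⟩ | ⟨l', h', x', y'⟩ | ⟨l', h', x', y'⟩ | ⟨l', h', x', y'⟩ | ⟨l', h', x', y'⟩ | ⟨l', x', y'⟩ <;>
          omega

/-- **`s4i` has four up steps**, at the times `2 * k + 2 * i + 2 * j + 4`, `6 * k - 2 * g - 2`, `6 * k`, `6 * k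
    + 2`. [cite: EntingJensen2009, §7.4.2, Fig. 7.10] -/
theorem stepsU_s4i {k i j d g m : ℕ} (hd : i + j + d + 4 ≤ k) (hgi : g ≤ i) (hm : m = 6 * k + 4) :
    stepsU m (s4i k i j d g) = {2 * k + 2 * i + 2 * j + 4, 6 * k - 2 * g - 2, 6 * k, 6 * k + 2} := by
  subst hm
  ext t
  simp only [stepsU, mem_filter, mem_range, mem_insert, mem_singleton]
  constructor
  · rintro ⟨ht, hx, hy⟩
    rw [(s4i_apply (t := t + 1) (by omega)).1, (s4i_apply (t := t) (by omega)).1] at hx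
    rw [(s4i_apply (t := t + 1) (by omega)).2, (s4i_apply (t := t) (by omega)).2] at hy
    rcases s4i_cases k i j d g t with ⟨h, x, y⟩ | ⟨l, h, x, y⟩ | ⟨l, h, x, y⟩ | ⟨l, h, x, y⟩ | ⟨l, h, x, y⟩ | ⟨l, h,
        x, y⟩ | ⟨l, h, x, y⟩ | ⟨l, h, x, y⟩ | ⟨l, x, y⟩ <;>
      rcases s4i_cases k i j d g (t + 1) with ⟨h', x', y'⟩ | ⟨l', h', x', y'⟩ | ⟨l', h', x', y'⟩ | ⟨l', h', x',
          y'⟩ | ⟨l', h', x', y'⟩ | ⟨l', h', x', y'⟩ | ⟨l', h', x', y'⟩ | ⟨l', h', x', y'⟩ | ⟨l', x', y'⟩ <;>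
        omega
  · intro ht
    have ht4 : t + 1 ≤ 6 * k + 4 := by omega
    refine ⟨by omega, ?_, ?_⟩
    · rw [(s4i_apply ht4).1, (s4i_apply (t := t) (by omega)).1]
      rcases s4i_cases k i j d g t with ⟨h, x, y⟩ | ⟨l, h, x, y⟩ | ⟨l, h, x, y⟩ | ⟨l, h, x, y⟩ | ⟨l, h, x, y⟩ | ⟨l,
          h, x, y⟩ | ⟨l, h, x, y⟩ | ⟨l, h, x, y⟩ | ⟨l, x, y⟩ <;>
        rcases s4i_cases k i j d g (t + 1) with ⟨h', x', y'⟩ | ⟨l', h', x', y'⟩ | ⟨l', h', x', y'⟩ | ⟨l', h', x',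
            y'⟩ | ⟨l', h', x', y'⟩ | ⟨l', h', x', y'⟩ | ⟨l', h', x', y'⟩ | ⟨l', h', x', y'⟩ | ⟨l', x', y'⟩ <;>
          omega
    · rw [(s4i_apply ht4).2, (s4i_apply (t := t) (by omega)).2]
      rcases s4i_cases k i j d g t with ⟨h, x, y⟩ | ⟨l, h, x, y⟩ | ⟨l, h, x, y⟩ | ⟨l, h, x, y⟩ | ⟨l, h, x, y⟩ | ⟨l,
          h, x, y⟩ | ⟨l, h, x, y⟩ | ⟨l, h, x, y⟩ | ⟨l, x, y⟩ <;>
        rcases s4i_cases k i j d g (t + 1) with ⟨h', x', y'⟩ | ⟨l', h', x', y'⟩ | ⟨l', h', x', y'⟩ | ⟨l', h', x',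
            y'⟩ | ⟨l', h', x', y'⟩ | ⟨l', h', x', y'⟩ | ⟨l', h', x', y'⟩ | ⟨l', h', x', y'⟩ | ⟨l', x', y'⟩ <;>
          omega


/-! ### §6  Family B5 (`D D U U D D U U`,
    span `2k+4`: two hairpin bodies of width `2` joined by a wall run): `R^{2a+1} D L^{2a−1} D R^{2a} U R U
    R^{2k−2a−2} D L^{2k−2a−3} D R^{2k−2a−2} U R U R` -/

/-- Column table of the s4j blocks (length `6k + 4`, vertical profile `D D U U D D U U`),
    9 affine pieces on the rows `0, −1, −2, −1, 0, −1, −2, −1, 0` (values `(t : ℤ)`, `-(t : ℤ) + 4 * a + 3`,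
    `(t : ℤ) - 4 * a`, `(t : ℤ) - 4 * a - 1`, `(t : ℤ) - 4 * a - 2`, `-(t : ℤ) + 4 * k + 4 * a + 5`,
    `(t : ℤ) - 4 * k + 2`, `(t : ℤ) - 4 * k + 1`,
    `(t : ℤ) - 4 * k` on the successive pieces). [cite: EntingJensen2009, §7.4.2,
    Fig. 7.10 (brickwork form of the honeycomb lattice)] -/
def s4jX (k a t : ℕ) : ℤ :=
  if t ≤ 2 * a + 1 then (t : ℤ)
  else if t ≤ 4 * a + 1 then -(t : ℤ) + 4 * a + 3
  else if t ≤ 6 * a + 2 then (t : ℤ) - 4 * a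
  else if t ≤ 6 * a + 4 then (t : ℤ) - 4 * a - 1
  else if t ≤ 2 * k + 4 * a + 3 then (t : ℤ) - 4 * a - 2
  else if t ≤ 4 * k + 2 * a + 1 then -(t : ℤ) + 4 * k + 4 * a + 5
  else if t ≤ 6 * k then (t : ℤ) - 4 * k + 2
  else if t ≤ 6 * k + 2 then (t : ℤ) - 4 * k + 1
  else (t : ℤ) - 4 * k

/-- Height table of the s4j blocks: `0, −1, −2, −1, 0, −1, −2, −1, 0` on the 9 pieces. [cite: EntingJensen2009,
    §7.4.2, Fig. 7.10] -/
def s4jY (k a t : ℕ) : ℤ :=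
  if t ≤ 2 * a + 1 then 0
  else if t ≤ 4 * a + 1 then -1
  else if t ≤ 6 * a + 2 then -2
  else if t ≤ 6 * a + 4 then -1
  else if t ≤ 2 * k + 4 * a + 3 then 0
  else if t ≤ 4 * k + 2 * a + 1 then -1
  else if t ≤ 6 * k then -2
  else if t ≤ 6 * k + 2 then -1
  else 0

/-- **The B5 block** `(0,0)→…→(2a+1,0)↓←…←(2,−1)↓(2,−2)→…→(2a+2,−2)↑(2a+2,−1)→(2a+3,−1)↑(2a+3,0)` (first body),
    then `(2a+3,0)→…→(2k+1,0)↓←…←(2a+4,−1)↓(2a+4,−2)→…→(2k+2,−2)↑(2k+2,−1)→(2k+3,−1)↑(2k+3,0)→(2k+4,0)` (wall run,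
    second body, exit), of length `6k+4`. [cite: EntingJensen2009, §7.4.2, Fig. 7.10] -/
def s4j (k a : ℕ) : ℕ → Site 2 := Tab.walk (6 * k + 4) (s4jX k a) (s4jY k a)

/-- The affine pieces of the tables of `s4j`, with their values. [cite: EntingJensen2009, §7.4.2, Fig. 7.10] -/
private theorem s4j_cases (k a t : ℕ) :
    (t ≤ 2 * a + 1 ∧ s4jX k a t = (t : ℤ) ∧ s4jY k a t = 0) ∨
      (2 * a + 2 ≤ t ∧ t ≤ 4 * a + 1 ∧ s4jX k a t = -(t : ℤ) + 4 * a + 3 ∧ s4jY k a t = -1) ∨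
      (4 * a + 2 ≤ t ∧ t ≤ 6 * a + 2 ∧ s4jX k a t = (t : ℤ) - 4 * a ∧ s4jY k a t = -2) ∨
      (6 * a + 3 ≤ t ∧ t ≤ 6 * a + 4 ∧ s4jX k a t = (t : ℤ) - 4 * a - 1 ∧ s4jY k a t = -1) ∨
      (6 * a + 5 ≤ t ∧ t ≤ 2 * k + 4 * a + 3 ∧ s4jX k a t = (t : ℤ) - 4 * a - 2 ∧ s4jY k a t = 0) ∨
      (2 * k + 4 * a + 4 ≤ t ∧ t ≤ 4 * k + 2 * a + 1 ∧ s4jX k a t = -(t : ℤ) + 4 * k + 4 * a + 5 ∧ s4jY k a t = -1) ∨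
      (4 * k + 2 * a + 2 ≤ t ∧ t ≤ 6 * k ∧ s4jX k a t = (t : ℤ) - 4 * k + 2 ∧ s4jY k a t = -2) ∨
      (6 * k + 1 ≤ t ∧ t ≤ 6 * k + 2 ∧ s4jX k a t = (t : ℤ) - 4 * k + 1 ∧ s4jY k a t = -1) ∨
      (6 * k + 3 ≤ t ∧ s4jX k a t = (t : ℤ) - 4 * k ∧ s4jY k a t = 0) := by
  simp only [s4jX, s4jY]
  split_ifs
  · exact Or.inl ⟨by omega, by omega, by omega⟩
  · exact Or.inr (Or.inl ⟨by omega, by omega, by omega, by omega⟩)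
  · exact Or.inr (Or.inr (Or.inl ⟨by omega, by omega, by omega, by omega⟩))
  · exact Or.inr (Or.inr (Or.inr (Or.inl ⟨by omega, by omega, by omega, by omega⟩)))
  · exact Or.inr (Or.inr (Or.inr (Or.inr (Or.inl ⟨by omega, by omega, by omega, by omega⟩))))
  · exact Or.inr (Or.inr (Or.inr (Or.inr (Or.inr (Or.inl ⟨by omega, by omega, by omega, by omega⟩)))))
  · exact Or.inr (Or.inr (Or.inr (Or.inr (Or.inr (Or.inr (Or.inl ⟨by omega, by omega, by omega, by omega⟩))))))
  · exact Or.inr (Or.inr (Or.inr (Or.inr (Or.inr (Or.inr (Or.inr (Or.inl ⟨by omega, by omega, by omega, by omega⟩)))))))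
  · exact Or.inr (Or.inr (Or.inr (Or.inr (Or.inr (Or.inr (Or.inr (Or.inr (⟨by omega, by omega, by omega⟩))))))))

/-- **Coordinate facts of `s4j`** (`1 ≤ a`, `a + 2 ≤ k`): brick-wall steps, self-avoidance, lower half-plane, columns in
`[0, X_L]` and `≥ 1` after time `0`, start and end on the wall, even length. [cite: EntingJensen2009, §7.4.2, Fig. 7.10]
[cite: MadrasSlade1993, §1.2, Definition 1.2.4 (bridges, p. 11)] -/
theorem s4j_facts {k a : ℕ} (ha : 1 ≤ a) (hak : a + 2 ≤ k) : Tab.Facts (6 * k + 4) (s4jX k a) (s4jY k a) := by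
  refine ⟨fun t ht => ?_, fun t ht s hs hx hy => ?_, fun t ht => ?_, fun t ht => ?_, ?_, ?_, ?_, by omega,
      fun t ht h1 => ?_⟩
  · rw [adjE_iff_fs]
    rcases s4j_cases k a t with ⟨h, x, y⟩ | ⟨l, h, x, y⟩ | ⟨l, h, x, y⟩ | ⟨l, h, x, y⟩ | ⟨l, h, x, y⟩ | ⟨l, h, x,
        y⟩ | ⟨l, h, x, y⟩ | ⟨l, h, x, y⟩ | ⟨l, x, y⟩ <;>
      rcases s4j_cases k a (t + 1) with ⟨h', x', y'⟩ | ⟨l', h', x', y'⟩ | ⟨l', h', x', y'⟩ | ⟨l', h', x', y'⟩ | ⟨l',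
          h', x', y'⟩ | ⟨l', h', x', y'⟩ | ⟨l', h', x', y'⟩ | ⟨l', h', x', y'⟩ | ⟨l', x', y'⟩ <;>
        omega
  · rcases s4j_cases k a t with ⟨h, x, y⟩ | ⟨l, h, x, y⟩ | ⟨l, h, x, y⟩ | ⟨l, h, x, y⟩ | ⟨l, h, x, y⟩ | ⟨l, h, x,
      y⟩ | ⟨l, h, x, y⟩ | ⟨l, h, x, y⟩ | ⟨l, x, y⟩ <;>
      rcases s4j_cases k a s with ⟨h', x', y'⟩ | ⟨l', h', x', y'⟩ | ⟨l', h', x', y'⟩ | ⟨l', h', x', y'⟩ | ⟨l', h',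
          x', y'⟩ | ⟨l', h', x', y'⟩ | ⟨l', h', x', y'⟩ | ⟨l', h', x', y'⟩ | ⟨l', x', y'⟩ <;>
        omega
  · rcases s4j_cases k a t with ⟨h, x, y⟩ | ⟨l, h, x, y⟩ | ⟨l, h, x, y⟩ | ⟨l, h, x, y⟩ | ⟨l, h, x, y⟩ | ⟨l, h, x,
      y⟩ | ⟨l, h, x, y⟩ | ⟨l, h, x, y⟩ | ⟨l, x, y⟩ <;> omega
  · have h0 := s4j_cases k a 0
    have hL := s4j_cases k a (6 * k + 4)
    rcases s4j_cases k a t with ⟨h, x, y⟩ | ⟨l, h, x, y⟩ | ⟨l, h, x, y⟩ | ⟨l, h, x, y⟩ | ⟨l, h, x, y⟩ | ⟨l, h, x,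
        y⟩ | ⟨l, h, x, y⟩ | ⟨l, h, x, y⟩ | ⟨l, x, y⟩ <;> omega
  · have h0 := s4j_cases k a 0; omega
  · have h0 := s4j_cases k a 0; omega
  · have hL := s4j_cases k a (6 * k + 4); omega
  · rcases s4j_cases k a t with ⟨h, x, y⟩ | ⟨l, h, x, y⟩ | ⟨l, h, x, y⟩ | ⟨l, h, x, y⟩ | ⟨l, h, x, y⟩ | ⟨l, h, x,
      y⟩ | ⟨l, h, x, y⟩ | ⟨l, h, x, y⟩ | ⟨l, x, y⟩ <;> omega

/-- `s4j` is a positive wall bridge of length `m = 6k + 4` (length symbolic). [cite: MadrasSlade1993, §1.2,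
    Definition 1.2.4 (p. 11)]
[cite: EntingJensen2009, §7.4.2, Fig. 7.10] -/
theorem s4j_mem_pwb {k a m : ℕ} (ha : 1 ≤ a) (hak : a + 2 ≤ k) (hm : m = 6 * k + 4) : s4j k a ∈ pwb m :=
  mem_pwb_of_facts rfl (s4j_facts ha hak) hm

/-- Coordinates of `s4j` up to its length. [cite: EntingJensen2009, §7.4.2, Fig. 7.10] -/
theorem s4j_apply {k a t : ℕ} (ht : t ≤ 6 * k + 4) : s4j k a t 0 = s4jX k a t ∧ s4j k a t 1 = s4jY k a t :=
  tab_walk_apply ht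

/-- **`s4j` is irreducible**: the interior visits of the initial wall run are followed by the return to column `2`,
    those of the middle wall run (columns `≥ 2a+4`) by the second body's return to column `2a+4`; the final wall run
    is a single step. [cite: MadrasSlade1993, §4.2, Definition 4.2.1 (p. 90)]
[cite: Kesten1963SAW, §4] [cite: EntingJensen2009, §7.4.2, Fig. 7.10] -/
theorem s4j_mem_ipwb {k a m : ℕ} (ha : 1 ≤ a) (hak : a + 2 ≤ k) (hm : m = 6 * k + 4) : s4j k a ∈ ipwb m := by
  refine mem_ipwb_of_facts_wit rfl (s4j_facts ha hak) hm (by omega) fun t ht1 ht2 hte hY => ?_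
  rcases s4j_cases k a t with ⟨h, x, y⟩ | ⟨l, h, x, y⟩ | ⟨l, h, x, y⟩ | ⟨l, h, x, y⟩ | ⟨l, h, x, y⟩ | ⟨l, h, x,
      y⟩ | ⟨l, h, x, y⟩ | ⟨l, h, x, y⟩ | ⟨l, x, y⟩
  · refine Or.inl ⟨4 * a + 1, by omega, by omega, ?_⟩
    rcases s4j_cases k a (4 * a + 1) with ⟨h', x', y'⟩ | ⟨l', h', x', y'⟩ | ⟨l', h', x', y'⟩ | ⟨l', h', x',
        y'⟩ | ⟨l', h', x', y'⟩ | ⟨l', h', x', y'⟩ | ⟨l', h', x', y'⟩ | ⟨l', h', x', y'⟩ | ⟨l', x', y'⟩ <;>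
      omega
  · omega
  · omega
  · omega
  · refine Or.inl ⟨4 * k + 2 * a + 1, by omega, by omega, ?_⟩
    rcases s4j_cases k a (4 * k + 2 * a + 1) with ⟨h', x', y'⟩ | ⟨l', h', x', y'⟩ | ⟨l', h', x', y'⟩ | ⟨l', h', x',
        y'⟩ | ⟨l', h', x', y'⟩ | ⟨l', h', x', y'⟩ | ⟨l', h', x', y'⟩ | ⟨l', h', x', y'⟩ | ⟨l', x', y'⟩ <;>
      omega
  · omega
  · omega
  · omega
  · omega

/-- **`s4j` has `k` visits** (`a` on the initial wall run, `k − 1 − a` on the middle one, and the endpoint).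
[cite: BeatonBousquetMelouDeGierDuminilCopinGuttmann2014, §3.1 (arXiv v5 p. 8)] [cite: EntingJensen2009, §7.4.2,
    Fig. 7.10] -/
theorem visits_s4j {k a m : ℕ} (ha : 1 ≤ a) (hak : a + 2 ≤ k) (hm : m = 6 * k + 4) : visits m (s4j k a) = k := by
  have hY : ∀ t, t ≤ 6 * k + 4 → s4j k a t 1 = s4jY k a t := fun t ht => (s4j_apply ht).2
  have h1 : visits (0 + (2 * a + 1)) (s4j k a) = visits (0) (s4j k a) + ((0 + (2 * a + 1)) / 2 - (0) / 2) :=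
    visits_add_of_wall fun q _ hq => by
      rw [hY _ (by omega)]
      rcases s4j_cases k a (0 + q) with ⟨h', x', y'⟩ | ⟨l', h', x', y'⟩ | ⟨l', h', x', y'⟩ | ⟨l', h', x', y'⟩ | ⟨l',
          h', x', y'⟩ | ⟨l', h', x', y'⟩ | ⟨l', h', x', y'⟩ | ⟨l', h', x', y'⟩ | ⟨l', x', y'⟩ <;>
        omega
  have h2 : visits (2 * a + 1 + (4 * a + 3)) (s4j k a) = visits (2 * a + 1) (s4j k a) :=
    visits_add_eq_left fun q hq1 hq2 h => by
      obtain ⟨-, h0⟩ := h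
      rw [hY _ (by omega)] at h0
      rcases s4j_cases k a (2 * a + 1 + q) with ⟨h', x', y'⟩ | ⟨l', h', x', y'⟩ | ⟨l', h', x', y'⟩ | ⟨l', h', x',
          y'⟩ | ⟨l', h', x', y'⟩ | ⟨l', h', x', y'⟩ | ⟨l', h', x', y'⟩ | ⟨l', h', x', y'⟩ | ⟨l', x', y'⟩ <;> omega
  have h3 : visits (6 * a + 4 + (2 * k - 2 * a - 1)) (s4j k a) = visits (6 * a + 4) (s4j k a) + ((6 * a + 4
      + (2 * k - 2 * a - 1)) / 2 - (6 * a + 4) / 2) :=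
    visits_add_of_wall fun q _ hq => by
      rw [hY _ (by omega)]
      rcases s4j_cases k a (6 * a + 4 + q) with ⟨h', x', y'⟩ | ⟨l', h', x', y'⟩ | ⟨l', h', x', y'⟩ | ⟨l', h', x',
          y'⟩ | ⟨l', h', x', y'⟩ | ⟨l', h', x', y'⟩ | ⟨l', h', x', y'⟩ | ⟨l', h', x', y'⟩ | ⟨l', x', y'⟩ <;>
        omega
  have h4 : visits (2 * k + 4 * a + 3 + (4 * k - 4 * a - 1)) (s4j k a) = visits (2 * k + 4 * a + 3) (s4j k a) :=
    visits_add_eq_left fun q hq1 hq2 h => by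
      obtain ⟨-, h0⟩ := h
      rw [hY _ (by omega)] at h0
      rcases s4j_cases k a (2 * k + 4 * a + 3 + q) with ⟨h', x', y'⟩ | ⟨l', h', x', y'⟩ | ⟨l', h', x', y'⟩ | ⟨l', h',
          x', y'⟩ | ⟨l', h', x', y'⟩ | ⟨l', h', x', y'⟩ | ⟨l', h', x', y'⟩ | ⟨l', h', x', y'⟩ | ⟨l', x', y'⟩ <;> omega
  have h5 : visits (6 * k + 2 + (2)) (s4j k a) = visits (6 * k + 2) (s4j k a) + ((6 * k + 2 + (2)) / 2 - (6 * k
      + 2) / 2) :=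
    visits_add_of_wall fun q _ hq => by
      rw [hY _ (by omega)]
      rcases s4j_cases k a (6 * k + 2 + q) with ⟨h', x', y'⟩ | ⟨l', h', x', y'⟩ | ⟨l', h', x', y'⟩ | ⟨l', h', x',
          y'⟩ | ⟨l', h', x', y'⟩ | ⟨l', h', x', y'⟩ | ⟨l', h', x', y'⟩ | ⟨l', h', x', y'⟩ | ⟨l', x', y'⟩ <;>
        omega
  rw [zero_add, visits_zero, zero_add] at h1
  rw [show 2 * a + 1 + (4 * a + 3) = 6 * a + 4 by omega, h1] at h2
  rw [show 6 * a + 4 + (2 * k - 2 * a - 1) = 2 * k + 4 * a + 3 by omega, h2] at h3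
  rw [show 2 * k + 4 * a + 3 + (4 * k - 4 * a - 1) = 6 * k + 2 by omega, h3] at h4
  rw [show 6 * k + 2 + (2) = 6 * k + 4 by omega, h4] at h5
  subst hm
  rw [h5]
  omega

/-- **`s4j` has four down steps**, at the times `2 * a + 1`, `4 * a + 1`, `2 * k + 4 * a + 3`, `4 * k + 2 * a
    + 1`. [cite: EntingJensen2009, §7.4.2, Fig. 7.10] -/
theorem stepsD_s4j {k a m : ℕ} (ha : 1 ≤ a) (hak : a + 2 ≤ k) (hm : m = 6 * k + 4) :
    stepsD m (s4j k a) = {2 * a + 1, 4 * a + 1, 2 * k + 4 * a + 3, 4 * k + 2 * a + 1} := by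
  subst hm
  ext t
  simp only [stepsD, mem_filter, mem_range, mem_insert, mem_singleton]
  constructor
  · rintro ⟨ht, hx, hy⟩
    rw [(s4j_apply (t := t + 1) (by omega)).1, (s4j_apply (t := t) (by omega)).1] at hx
    rw [(s4j_apply (t := t + 1) (by omega)).2, (s4j_apply (t := t) (by omega)).2] at hy
    rcases s4j_cases k a t with ⟨h, x, y⟩ | ⟨l, h, x, y⟩ | ⟨l, h, x, y⟩ | ⟨l, h, x, y⟩ | ⟨l, h, x, y⟩ | ⟨l, h, x,
        y⟩ | ⟨l, h, x, y⟩ | ⟨l, h, x, y⟩ | ⟨l, x, y⟩ <;>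
      rcases s4j_cases k a (t + 1) with ⟨h', x', y'⟩ | ⟨l', h', x', y'⟩ | ⟨l', h', x', y'⟩ | ⟨l', h', x', y'⟩ | ⟨l',
          h', x', y'⟩ | ⟨l', h', x', y'⟩ | ⟨l', h', x', y'⟩ | ⟨l', h', x', y'⟩ | ⟨l', x', y'⟩ <;>
        omega
  · intro ht
    have ht4 : t + 1 ≤ 6 * k + 4 := by omega
    refine ⟨by omega, ?_, ?_⟩
    · rw [(s4j_apply ht4).1, (s4j_apply (t := t) (by omega)).1]
      rcases s4j_cases k a t with ⟨h, x, y⟩ | ⟨l, h, x, y⟩ | ⟨l, h, x, y⟩ | ⟨l, h, x, y⟩ | ⟨l, h, x, y⟩ | ⟨l, h, x,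
          y⟩ | ⟨l, h, x, y⟩ | ⟨l, h, x, y⟩ | ⟨l, x, y⟩ <;>
        rcases s4j_cases k a (t + 1) with ⟨h', x', y'⟩ | ⟨l', h', x', y'⟩ | ⟨l', h', x', y'⟩ | ⟨l', h', x',
            y'⟩ | ⟨l', h', x', y'⟩ | ⟨l', h', x', y'⟩ | ⟨l', h', x', y'⟩ | ⟨l', h', x', y'⟩ | ⟨l', x', y'⟩ <;>
          omega
    · rw [(s4j_apply ht4).2, (s4j_apply (t := t) (by omega)).2]
      rcases s4j_cases k a t with ⟨h, x, y⟩ | ⟨l, h, x, y⟩ | ⟨l, h, x, y⟩ | ⟨l, h, x, y⟩ | ⟨l, h, x, y⟩ | ⟨l, h, x,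
          y⟩ | ⟨l, h, x, y⟩ | ⟨l, h, x, y⟩ | ⟨l, x, y⟩ <;>
        rcases s4j_cases k a (t + 1) with ⟨h', x', y'⟩ | ⟨l', h', x', y'⟩ | ⟨l', h', x', y'⟩ | ⟨l', h', x',
            y'⟩ | ⟨l', h', x', y'⟩ | ⟨l', h', x', y'⟩ | ⟨l', h', x', y'⟩ | ⟨l', h', x', y'⟩ | ⟨l', x', y'⟩ <;>
          omega

/-- **`s4j` has four up steps**, at the times `6 * a + 2`, `6 * a + 4`, `6 * k`, `6 * k
    + 2`. [cite: EntingJensen2009, §7.4.2, Fig. 7.10] -/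
theorem stepsU_s4j {k a m : ℕ} (ha : 1 ≤ a) (hak : a + 2 ≤ k) (hm : m = 6 * k + 4) :
    stepsU m (s4j k a) = {6 * a + 2, 6 * a + 4, 6 * k, 6 * k + 2} := by
  subst hm
  ext t
  simp only [stepsU, mem_filter, mem_range, mem_insert, mem_singleton]
  constructor
  · rintro ⟨ht, hx, hy⟩
    rw [(s4j_apply (t := t + 1) (by omega)).1, (s4j_apply (t := t) (by omega)).1] at hx
    rw [(s4j_apply (t := t + 1) (by omega)).2, (s4j_apply (t := t) (by omega)).2] at hy
    rcases s4j_cases k a t with ⟨h, x, y⟩ | ⟨l, h, x, y⟩ | ⟨l, h, x, y⟩ | ⟨l, h, x, y⟩ | ⟨l, h, x, y⟩ | ⟨l, h, x,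
        y⟩ | ⟨l, h, x, y⟩ | ⟨l, h, x, y⟩ | ⟨l, x, y⟩ <;>
      rcases s4j_cases k a (t + 1) with ⟨h', x', y'⟩ | ⟨l', h', x', y'⟩ | ⟨l', h', x', y'⟩ | ⟨l', h', x', y'⟩ | ⟨l',
          h', x', y'⟩ | ⟨l', h', x', y'⟩ | ⟨l', h', x', y'⟩ | ⟨l', h', x', y'⟩ | ⟨l', x', y'⟩ <;>
        omega
  · intro ht
    have ht4 : t + 1 ≤ 6 * k + 4 := by omega
    refine ⟨by omega, ?_, ?_⟩
    · rw [(s4j_apply ht4).1, (s4j_apply (t := t) (by omega)).1]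
      rcases s4j_cases k a t with ⟨h, x, y⟩ | ⟨l, h, x, y⟩ | ⟨l, h, x, y⟩ | ⟨l, h, x, y⟩ | ⟨l, h, x, y⟩ | ⟨l, h, x,
          y⟩ | ⟨l, h, x, y⟩ | ⟨l, h, x, y⟩ | ⟨l, x, y⟩ <;>
        rcases s4j_cases k a (t + 1) with ⟨h', x', y'⟩ | ⟨l', h', x', y'⟩ | ⟨l', h', x', y'⟩ | ⟨l', h', x',
            y'⟩ | ⟨l', h', x', y'⟩ | ⟨l', h', x', y'⟩ | ⟨l', h', x', y'⟩ | ⟨l', h', x', y'⟩ | ⟨l', x', y'⟩ <;>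
          omega
    · rw [(s4j_apply ht4).2, (s4j_apply (t := t) (by omega)).2]
      rcases s4j_cases k a t with ⟨h, x, y⟩ | ⟨l, h, x, y⟩ | ⟨l, h, x, y⟩ | ⟨l, h, x, y⟩ | ⟨l, h, x, y⟩ | ⟨l, h, x,
          y⟩ | ⟨l, h, x, y⟩ | ⟨l, h, x, y⟩ | ⟨l, x, y⟩ <;>
        rcases s4j_cases k a (t + 1) with ⟨h', x', y'⟩ | ⟨l', h', x', y'⟩ | ⟨l', h', x', y'⟩ | ⟨l', h', x',
            y'⟩ | ⟨l', h', x', y'⟩ | ⟨l', h', x', y'⟩ | ⟨l', h', x', y'⟩ | ⟨l', h', x', y'⟩ | ⟨l', x', y'⟩ <;>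
          omega


end Literature.Probability.RandomPlanarGeometry.SAW.HexBW.Wall
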